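import Mathlib
import Literature.Geometry.Symplectic.JHolomorphicCuspChart
import Literature.Geometry.Symplectic.JHolomorphicLocalBranchDichotomy
import Literature.Geometry.Symplectic.JHolomorphicLeadingTerm
import Literature.Geometry.Symplectic.JHolomorphicLocalIntersectionsProofs
import Literature.Geometry.Symplectic.JHolomorphicWeierstrassProofs
import HarnessLib

/-!
# Double points of perturbed cusps, VI: from the representation formula to the flat statement

This file closes the chain of files `JHolomorphicCuspDoublePointsDesign`, `…Model`,
`JHolomorphicCuspDoublePoints`, `JHolomorphicCuspPushoff`, `JHolomorphicCuspChart` proving the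
"immersed locus" half of McDuff's Theorem 1.1 [McDuff1991LocalBehaviour, Thm 1.1, Thm 1.5]:

* `cusp_doublePoints_of_representationFormula` — assuming Wendl's representation formula with
  branch comparison [Wendl2020, App. B, Thm B.23 and (B.12)] in the exact form `hX` used by
  `Literature.Geometry.Symplectic.jHolomorphic_localBranchDichotomy_of_representationFormula`,
  a smooth `J'`-holomorphic disc `f` in `ℝ⁴` (any smooth almost complex structure `J'`) which is
  injective on `|z| ≤ r`, immersed there off the centre and has `df(0) = 0`, is not the
  `C¹`-limit on `|z| ≤ r` of injective immersed `J'`-holomorphic discs: cofinitely many members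
  of such a sequence have a double point in `|z| ≤ r`. This is precisely the hypothesis `hcusp`
  of `Literature.Geometry.Symplectic.jHolomorphic_immersed_of_limitEmbedded_punctured_of_flat`.
* `jHolomorphic_immersed_of_limitEmbedded_punctured_of_representationFormula` — consequently the
  named fact `Literature.Geometry.Symplectic.jHolomorphic_immersed_of_limitEmbedded_punctured`
  (McDuff's Theorem 1.1 on the immersed locus, for almost complex 4-manifolds) follows from `hX`
  (using the Weierstrass theorem `JHolomorphicWeierstrassR4_holds` for the chart reduction).

## The argument

Following [McDuff1991LocalBehaviour, §2, (2.6)–(2.7) and Lemma 2.7] in the normal form of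
[Wendl2020, Thm B.23]: `hX` writes `Θ (f z) = (ξ(z)ᵏ, û(ξ z))` with a smooth chart `Θ` and a `C¹`
chart `ξ`. `chart_tangent_data` extracts the first-order information which the statement of B.23
leaves implicit but its proof provides: applying the leading-order expansion with derivative
control (`Literature.Geometry.Symplectic.jHolomorphic_leadingTerm`, [Wendl2020, Cor. B.21]) to the
smooth `J̃`-holomorphic curve `Θ ∘ f` (`J̃ = Θ_* J'`) and comparing orders of vanishing with the
chart form gives (i) `k ≥ 2` when `df(0) = 0`, (ii) `J̃(0)` preserves the tangent line `ℂ × {0}`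
of the cusp, (iii) `dû(w) = O(|w|ᵏ)`. Injectivity of `f` excludes the rotation-invariant
alternative of `hX` for every nontrivial `k`-th root of unity
(`localBranch_partners_of_rotationInvariant`), so all `k - 1` branch pairs are aligned with
orders `m_μ > k`, whence `Σ m_μ > k - 1`. The chart theorem `not_injOn_of_chartCusp` then yields
`s, δ` such that every `J̃`-holomorphic immersed `g` `δ`-close in `C¹` to `w ↦ (wᵏ, û w)` on
`|w| ≤ s` has a double point; for `n ≫ 0` the curve `g = Θ ∘ f'ₙ ∘ ξ⁻¹` qualifies (uniform
continuity of `Θ`, `DΘ` on a compact thickening of `f(|z| ≤ ρ₂)` inside the chart source), and a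
double point of `g` in `|w| ≤ s` is a double point of `f'ₙ` in `|z| ≤ r`.

What remains open towards `jHolomorphic_immersed_of_limitEmbedded_punctured_holds` is exactly
`hX`, the representation formula [Wendl2020, Thm B.23] (whose rotation clause is (B.12)); it is
the common hypothesis of this file and of `JHolomorphicLocalBranchDichotomy`.

## References

* [McDuff1991LocalBehaviour] D. McDuff, *The local behaviour of holomorphic curves in almost
  complex 4-manifolds*, J. Differential Geom. 34 (1991) 143–164, Thm 1.1, Lemma 1.4, Thm 1.5, §2.
* [Wendl2020] C. Wendl, *Lectures on contact 3-manifolds, holomorphic curves and intersection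
  theory*, Cambridge Univ. Press 2020, App. B: Thm B.18, Cor. B.21, Thm B.23, Ex. B.25, Thm B.34.
* [MicallefWhite1995] M. Micallef, B. White, Ann. of Math. 141 (1995) 35–85, Thms 6.1, 6.2, 7.1.
-/

noncomputable section

open scoped Real ComplexConjugate Topology ContDiff
open Complex Set Filter Metric Asymptotics Function Literature.Topology.PlaneTopology

namespace Literature.Geometry.Symplectic

namespace CuspDoublePoints

/-! ### Calculus of charts -/

section Charts

variable {X Y : Type*} [NormedAddCommGroup X] [NormedSpace ℝ X] [NormedAddCommGroup Y]
  [NormedSpace ℝ Y]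

/-- The differentials of a `C¹` chart and of its `C¹` inverse are inverse to each other.
[folklore] -/
theorem fderiv_comp_fderiv_symm (Θ : OpenPartialHomeomorph X Y) (hΘ : ContDiffOn ℝ 1 Θ Θ.source)
    (hΘs : ContDiffOn ℝ 1 Θ.symm Θ.target) {x : Y} (hx : x ∈ Θ.target) :
    (fderiv ℝ Θ (Θ.symm x)).comp (fderiv ℝ Θ.symm x) = ContinuousLinearMap.id ℝ Y ∧
      (fderiv ℝ Θ.symm x).comp (fderiv ℝ Θ (Θ.symm x)) = ContinuousLinearMap.id ℝ X := by
  have hy : Θ.symm x ∈ Θ.source := Θ.map_target hx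
  have hdΘ : HasFDerivAt Θ (fderiv ℝ Θ (Θ.symm x)) (Θ.symm x) :=
    ((hΘ.differentiableOn_one _ hy).differentiableAt (Θ.open_source.mem_nhds hy)).hasFDerivAt
  have hdΘs : HasFDerivAt Θ.symm (fderiv ℝ Θ.symm x) x :=
    ((hΘs.differentiableOn_one _ hx).differentiableAt (Θ.open_target.mem_nhds hx)).hasFDerivAt
  constructor
  · have h1 : HasFDerivAt (Θ ∘ Θ.symm) ((fderiv ℝ Θ (Θ.symm x)).comp (fderiv ℝ Θ.symm x)) x :=
      hdΘ.comp x hdΘs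
    have h2 : HasFDerivAt (Θ ∘ Θ.symm) (ContinuousLinearMap.id ℝ Y) x := by
      refine (hasFDerivAt_id x).congr_of_eventuallyEq ?_
      filter_upwards [Θ.open_target.mem_nhds hx] with y hy
      exact Θ.right_inv hy
    exact h1.unique h2
  · have h1 : HasFDerivAt (Θ.symm ∘ Θ) ((fderiv ℝ Θ.symm x).comp (fderiv ℝ Θ (Θ.symm x))) (Θ.symm x) := by
      have h3 : HasFDerivAt Θ.symm (fderiv ℝ Θ.symm x) (Θ (Θ.symm x)) := by
        rw [Θ.right_inv hx]; exact hdΘs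
      exact h3.comp (Θ.symm x) hdΘ
    have h2 : HasFDerivAt (Θ.symm ∘ Θ) (ContinuousLinearMap.id ℝ X) (Θ.symm x) := by
      refine (hasFDerivAt_id _).congr_of_eventuallyEq ?_
      filter_upwards [Θ.open_source.mem_nhds hy] with y hy'
      exact Θ.left_inv hy'
    exact h1.unique h2

/-- **The transported almost complex structure.** For a `C¹` chart `Θ` with `C¹` inverse and a
continuous `J` with `J² = -1`, the conjugated structure
`J̃(x) = DΘ(Θ⁻¹x) ∘ J(Θ⁻¹x) ∘ D(Θ⁻¹)(x)` is continuous on the target of the chart and squares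
to `-1` there. [folklore] -/
theorem transportedStructure_props (Θ : OpenPartialHomeomorph X Y) (hΘ : ContDiffOn ℝ 1 Θ Θ.source)
    (hΘs : ContDiffOn ℝ 1 Θ.symm Θ.target) {J : X → X →L[ℝ] X} (hJ : Continuous J)
    (hJ2 : ∀ x v, J x (J x v) = -v) :
    ContinuousOn (fun x => (fderiv ℝ Θ (Θ.symm x)).comp ((J (Θ.symm x)).comp (fderiv ℝ Θ.symm x)))
        Θ.target ∧
      ∀ x ∈ Θ.target, ∀ v,
        ((fderiv ℝ Θ (Θ.symm x)).comp ((J (Θ.symm x)).comp (fderiv ℝ Θ.symm x)))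
          (((fderiv ℝ Θ (Θ.symm x)).comp ((J (Θ.symm x)).comp (fderiv ℝ Θ.symm x))) v) = -v := by
  constructor
  · have h1 : ContinuousOn (fun x => fderiv ℝ Θ (Θ.symm x)) Θ.target :=
      (hΘ.continuousOn_fderiv_of_isOpen Θ.open_source le_rfl).comp Θ.continuousOn_symm
        fun x hx => Θ.map_target hx
    have h2 : ContinuousOn (fun x => J (Θ.symm x)) Θ.target :=
      hJ.comp_continuousOn Θ.continuousOn_symm
    have h3 : ContinuousOn (fun x => fderiv ℝ Θ.symm x) Θ.target :=
      hΘs.continuousOn_fderiv_of_isOpen Θ.open_target le_rfl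
    exact h1.clm_comp (h2.clm_comp h3)
  · intro x hx v
    obtain ⟨-, h2⟩ := fderiv_comp_fderiv_symm Θ hΘ hΘs hx
    simp only [ContinuousLinearMap.comp_apply]
    have : fderiv ℝ Θ.symm x (fderiv ℝ Θ (Θ.symm x) (J (Θ.symm x) (fderiv ℝ Θ.symm x v))) =
        J (Θ.symm x) (fderiv ℝ Θ.symm x v) := by
      have := congrArg (fun L : X →L[ℝ] X => L (J (Θ.symm x) (fderiv ℝ Θ.symm x v))) h2
      simpa using this
    rw [this, hJ2, map_neg]
    obtain ⟨h1, -⟩ := fderiv_comp_fderiv_symm Θ hΘ hΘs hx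
    have := congrArg (fun L : Y →L[ℝ] Y => L v) h1
    simp only [ContinuousLinearMap.comp_apply, ContinuousLinearMap.id_apply] at this
    rw [this]

/-- **Complex tangent planes are transported to complex tangent planes.** If `D : ℂ → X` is
`i`-`J(q)`-intertwining, `P = DΘ(q)` with left inverse `P⁻¹ = DΘ⁻¹(Θ q)` and `σ` is an invertible
real-linear map of `ℂ`, then the plane spanned by `P ∘ D ∘ σ` is invariant under
`P ∘ J(q) ∘ P⁻¹`. [folklore] -/
theorem transported_range_invariant {J : X →L[ℝ] X} {D : ℂ →L[ℝ] X}
    (hD : ∀ α : ℂ, D (I * α) = J (D α)) {P : X →L[ℝ] Y} {Pinv : Y →L[ℝ] X}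
    (hP : Pinv.comp P = ContinuousLinearMap.id ℝ X) (σ : ℂ ≃L[ℝ] ℂ) (c : ℂ) :
    (P.comp (J.comp Pinv)) ((P.comp (D.comp (σ : ℂ →L[ℝ] ℂ))) c) ∈
      LinearMap.range ((P.comp (D.comp (σ : ℂ →L[ℝ] ℂ))) : ℂ →ₗ[ℝ] Y) := by
  refine ⟨σ.symm (I * σ c), ?_⟩
  simp only [ContinuousLinearMap.coe_coe, ContinuousLinearMap.comp_apply, ContinuousLinearEquiv.coe_coe,
    ContinuousLinearEquiv.apply_symm_apply, hD]
  have := congrArg (fun L : X →L[ℝ] X => L (D (σ c))) hP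
  simp only [ContinuousLinearMap.comp_apply, ContinuousLinearMap.id_apply] at this
  rw [this]

end Charts

/-! ### Two asymptotic lemmas -/

/-- Comparison of powers near `0`: `c |z|^a ≤ |z|^b` on a punctured neighbourhood forces
`b ≤ a`. [folklore] -/
theorem le_of_pow_le_pow_nhds {a b : ℕ} {c : ℝ} (hc : 0 < c)
    (h : ∀ᶠ z in 𝓝[≠] (0 : ℂ), c * ‖z‖ ^ a ≤ ‖z‖ ^ b) : b ≤ a := by
  by_contra hlt
  push Not at hlt
  -- for small `z ≠ 0`, `|z|^b = |z|^a |z|^(b-a) < c |z|^a`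
  have hsmall : ∀ᶠ z in 𝓝[≠] (0 : ℂ), ‖z‖ ^ (b - a) < c ∧ z ≠ 0 := by
    have h1 : Tendsto (fun z : ℂ => ‖z‖ ^ (b - a)) (𝓝 0) (𝓝 0) := by
      have : Tendsto (fun z : ℂ => ‖z‖) (𝓝 0) (𝓝 0) := by
        simpa using (continuous_norm.tendsto (0 : ℂ))
      simpa [zero_pow (Nat.sub_ne_zero_of_lt hlt)] using this.pow (b - a)
    have h2 : ∀ᶠ z in 𝓝 (0 : ℂ), ‖z‖ ^ (b - a) < c := h1 (Iio_mem_nhds hc)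
    exact (h2.filter_mono nhdsWithin_le_nhds).and self_mem_nhdsWithin
  obtain ⟨z, hz1, hz2, hz0⟩ := (h.and hsmall).exists
  have hpos : 0 < ‖z‖ ^ a := pow_pos (norm_pos_iff.2 hz0) a
  have : ‖z‖ ^ b < c * ‖z‖ ^ a := by
    rw [← Nat.add_sub_cancel' hlt.le, pow_add, mul_comm]
    exact mul_lt_mul_of_pos_right hz2 hpos
  linarith

/-- If `Re(zᵏ) p + Im(zᵏ) q = O(|z|^{k+1})` at `0` then `p = q = 0` (test `z = ε` and
`z = ε e^{iπ/2k}`). [folklore] -/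
theorem eq_zero_of_powCoeff_isBigO {k : ℕ} (hk : 0 < k) {p q : ℂ}
    (h : (fun z : ℂ => ((z ^ k).re : ℝ) • p + ((z ^ k).im : ℝ) • q) =O[𝓝 0]
      fun z : ℂ => ‖z‖ ^ (k + 1)) : p = 0 ∧ q = 0 := by
  obtain ⟨C, hC, hCb⟩ := h.exists_pos
  have hb := hCb.bound
  -- a general extraction: along `ε ↦ ε ζ` with `|ζ| = 1`, `ζᵏ` fixed
  have key : ∀ ζ : ℂ, ‖ζ‖ = 1 → ∀ v : ℂ,
      (∀ ε : ℝ, ((((ε : ℂ) * ζ) ^ k).re : ℝ) • p + ((((ε : ℂ) * ζ) ^ k).im : ℝ) • q = (ε ^ k : ℝ) • v) →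
      v = 0 := by
    intro ζ hζ v hv
    by_contra hv0
    have hvpos : 0 < ‖v‖ := norm_pos_iff.2 hv0
    -- pull the bound back along `ε ↦ ε ζ`
    have ht : Tendsto (fun ε : ℝ => (ε : ℂ) * ζ) (𝓝 0) (𝓝 0) := by
      have : Continuous fun ε : ℝ => (ε : ℂ) * ζ := continuous_ofReal.mul continuous_const
      simpa using this.tendsto 0
    have h1 : ∀ᶠ ε : ℝ in 𝓝 0, ‖(ε ^ k : ℝ) • v‖ ≤ C * ‖‖(ε : ℂ) * ζ‖ ^ (k + 1)‖ := by
      filter_upwards [ht.eventually hb] with ε hε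
      rwa [hv ε] at hε
    have h2 : ∀ᶠ ε : ℝ in 𝓝[>] 0, ‖v‖ ≤ C * ε := by
      filter_upwards [h1.filter_mono nhdsWithin_le_nhds, self_mem_nhdsWithin] with ε hε hε0
      have hε0' : (0 : ℝ) < ε := hε0
      have e1 : ‖(ε ^ k : ℝ) • v‖ = ε ^ k * ‖v‖ := by
        rw [norm_smul, Real.norm_of_nonneg (pow_nonneg hε0'.le _)]
      have e2 : ‖‖(ε : ℂ) * ζ‖ ^ (k + 1)‖ = ε ^ k * ε := by
        rw [norm_mul, Complex.norm_real, hζ, mul_one, Real.norm_eq_abs, Real.norm_eq_abs, abs_of_pos hε0',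
          abs_of_nonneg (pow_nonneg hε0'.le _), pow_succ]
      rw [e1, e2] at hε
      have hεk : 0 < ε ^ k := pow_pos hε0' k
      have : ε ^ k * ‖v‖ ≤ ε ^ k * (C * ε) := by linarith only [hε]
      exact le_of_mul_le_mul_left this hεk
    have h3 : ∀ᶠ ε : ℝ in 𝓝[>] 0, C * ε < ‖v‖ := by
      have : Tendsto (fun ε : ℝ => C * ε) (𝓝[>] 0) (𝓝 0) := by
        have : Tendsto (fun ε : ℝ => C * ε) (𝓝 0) (𝓝 (C * 0)) := tendsto_const_nhds.mul tendsto_id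
        rw [mul_zero] at this
        exact this.mono_left nhdsWithin_le_nhds
      exact this (Iio_mem_nhds hvpos)
    obtain ⟨ε, hε1, hε2⟩ := (h2.and h3).exists
    linarith
  constructor
  · refine key 1 (by simp) p fun ε => ?_
    rw [mul_one, ← ofReal_pow, ofReal_re, ofReal_im, zero_smul, add_zero]
  · -- `ζ = e^{iπ/(2k)}`, `ζᵏ = i`
    set ζ : ℂ := Complex.exp (((π / (2 * k) : ℝ) : ℂ) * I) with hζ
    have hζn : ‖ζ‖ = 1 := by rw [hζ, Complex.norm_exp_ofReal_mul_I]
    have hζk : ζ ^ k = I := by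
      rw [hζ, ← Complex.exp_nat_mul, ← mul_assoc]
      have : (k : ℂ) * ((π / (2 * k) : ℝ) : ℂ) = ((π / 2 : ℝ) : ℂ) := by
        have hk' : (k : ℂ) ≠ 0 := Nat.cast_ne_zero.2 hk.ne'
        push_cast
        field_simp
      rw [this]
      simp
    refine key ζ hζn q fun ε => ?_
    rw [mul_pow, hζk, ← ofReal_pow, re_ofReal_mul, im_ofReal_mul, I_re, I_im, mul_zero, mul_one,
      zero_smul, zero_add]


/-! ### Tangent data of the cusp in the chart -/

/-- A real-linear injection `ℂ → V` is bounded below. [folklore] -/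
theorem exists_bound_below_of_injective' {V : Type*} [NormedAddCommGroup V] [NormedSpace ℝ V]
    (T : ℂ →L[ℝ] V) (hT : Function.Injective T) : ∃ m > 0, ∀ c : ℂ, m * ‖c‖ ≤ ‖T c‖ := by
  have hc : IsCompact (sphere (0 : ℂ) 1) := isCompact_sphere 0 1
  have hne : (sphere (0 : ℂ) 1).Nonempty := ⟨1, by simp⟩
  obtain ⟨c₀, hc₀, hmin⟩ := hc.exists_isMinOn hne (T.continuous.norm.continuousOn)
  have hpos : 0 < ‖T c₀‖ := by
    refine norm_pos_iff.2 fun h0 => ?_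
    have : c₀ = 0 := hT (by rw [h0, map_zero])
    rw [this] at hc₀; simp at hc₀
  refine ⟨‖T c₀‖, hpos, fun c => ?_⟩
  rcases eq_or_ne c 0 with rfl | hc0
  · simp
  · have hn : 0 < ‖c‖ := norm_pos_iff.2 hc0
    have hmem : ((‖c‖⁻¹ : ℝ) : ℂ) * c ∈ sphere (0 : ℂ) 1 := by
      simp [inv_mul_cancel₀ hn.ne']
    have h1 : ‖T c₀‖ ≤ ‖T (((‖c‖⁻¹ : ℝ) : ℂ) * c)‖ := hmin hmem
    have h2 : T (((‖c‖⁻¹ : ℝ) : ℂ) * c) = (‖c‖⁻¹ : ℝ) • T c := by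
      rw [← Complex.real_smul, map_smul]
    rw [h2, norm_smul, norm_inv, Real.norm_of_nonneg hn.le] at h1
    rwa [le_inv_mul_iff₀ hn, mul_comm] at h1
set_option maxHeartbeats 400000 in -- buildfix (bf3-g26): 160k/180k FAIL, 200k PASS at accept time; line-neutral budget line
/-- **Tangent data of a `J`-curve in a `(ξᵏ, û∘ξ)` chart.** Let `u` be a smooth `J`-holomorphic
curve (`J ∈ C^∞`, `J² = -1`), represented in a smooth chart `Θ` about `u 0` (`Θ(u 0) = 0`) and
a `C¹` chart `ξ` about `0` as `Θ(u z) = (ξ(z)ᵏ, û(ξ z))` with `û ∈ C¹`, `û = O(|w|^{k+1})`,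
`k ≥ 1`. Then (i) `k ≥ 2` if `du(0) = 0`; (ii) the transported structure
`J̃(0) = DΘ J D(Θ⁻¹)` at `0` preserves the line `ℂ × {0}`; (iii) `dû(w) = O(|w|ᵏ)`. (The smooth
`J̃`-curve `Θ ∘ u` has a holomorphic leading term `zᵏ' t` with derivative control,
`Literature.Geometry.Symplectic.jHolomorphic_leadingTerm`; comparing orders of vanishing gives
`k' = k`, comparing second components gives `t ∈ ℂ × {0}`.)
[cite: McDuff1991LocalBehaviour, Lemma 2.7 and (2.6); Wendl2020, App. B, Cor. B.21, Thm B.23] -/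
theorem chart_tangent_data {F : Type*} [NormedAddCommGroup F] [NormedSpace ℝ F]
    [FiniteDimensional ℝ F]
    {J : F → F →L[ℝ] F} (hJ : ContDiff ℝ ∞ J) (hJ2 : ∀ x v, J x (J x v) = -v)
    {u : ℂ → F} {R : ℝ} (hu : ContDiffOn ℝ ∞ u (ball 0 R))
    (hhol : ∀ z ∈ ball (0 : ℂ) R, ∀ α : ℂ, fderiv ℝ u z (I * α) = J (u z) (fderiv ℝ u z α))
    {k : ℕ} (hk : 0 < k) {Θ : OpenPartialHomeomorph F (ℂ × ℂ)} {ξ : OpenPartialHomeomorph ℂ ℂ}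
    {û : ℂ → ℂ} {ρ : ℝ} (hρ : 0 < ρ) (hρR : ρ ≤ R)
    (hΘ0 : Θ (u 0) = 0) (hΘ : ContDiffOn ℝ ∞ Θ Θ.source)
    (hΘs : ContDiffOn ℝ ∞ Θ.symm Θ.target)
    (hξsrc : ball 0 ρ ⊆ ξ.source) (hξ0 : ξ 0 = 0) (hξ : ContDiffOn ℝ 1 ξ ξ.source)
    (hξs : ContDiffOn ℝ 1 ξ.symm ξ.target)
    (hûO : û =O[𝓝 0] fun w => ‖w‖ ^ (k + 1))
    (hrep : ∀ z ∈ ball (0 : ℂ) ρ, u z ∈ Θ.source ∧ Θ (u z) = ((ξ z) ^ k, û (ξ z))) :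
    (fderiv ℝ u 0 = 0 → 2 ≤ k) ∧
    (∀ x : ℂ, (((fderiv ℝ Θ (Θ.symm 0)).comp ((J (Θ.symm 0)).comp (fderiv ℝ Θ.symm 0)))
      (x, 0)).2 = 0) ∧
    (fun w => fderiv ℝ û w) =O[𝓝 0] fun w => ‖w‖ ^ k := by
  -- ### the chart structure and the curve in the chart
  set Jt : ℂ × ℂ → (ℂ × ℂ) →L[ℝ] (ℂ × ℂ) :=
    fun x => (fderiv ℝ Θ (Θ.symm x)).comp ((J (Θ.symm x)).comp (fderiv ℝ Θ.symm x)) with hJt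
  set G : ℂ → ℂ × ℂ := fun z => Θ (u z) with hG
  have hΘ1 : ContDiffOn ℝ 1 Θ Θ.source := hΘ.of_le (by norm_cast)
  have hΘs1 : ContDiffOn ℝ 1 Θ.symm Θ.target := hΘs.of_le (by norm_cast)
  have h0src : u 0 ∈ Θ.source := (hrep 0 (mem_ball_self hρ)).1
  have h0tgt : (0 : ℂ × ℂ) ∈ Θ.target := by rw [← hΘ0]; exact Θ.map_source h0src
  obtain ⟨-, hJt2⟩ := transportedStructure_props Θ hΘ1 hΘs1 hJ.continuous hJ2
  have hJt1 : ContDiffOn ℝ 1 Jt Θ.target := by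
    have h1 : ContDiffOn ℝ 1 (fun x => fderiv ℝ Θ (Θ.symm x)) Θ.target :=
      (hΘ.fderiv_of_isOpen Θ.open_source (by norm_cast)).comp hΘs1
        fun x hx => Θ.map_target hx
    have h2 : ContDiffOn ℝ 1 (fun x => J (Θ.symm x)) Θ.target :=
      (hJ.of_le (by norm_cast)).comp_contDiffOn hΘs1
    have h3 : ContDiffOn ℝ 1 (fderiv ℝ Θ.symm) Θ.target :=
      hΘs.fderiv_of_isOpen Θ.open_target (by norm_cast)
    exact h1.clm_comp (h2.clm_comp h3)
  have husrc : ∀ z ∈ ball (0 : ℂ) ρ, u z ∈ Θ.source := fun z hz => (hrep z hz).1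
  have huρ : ContDiffOn ℝ ∞ u (ball 0 ρ) := hu.mono (ball_subset_ball hρR)
  have hGs : ContDiffOn ℝ ∞ G (ball 0 ρ) := hΘ.comp huρ husrc
  have hGU : MapsTo G (ball 0 ρ) Θ.target := fun z hz => Θ.map_source (husrc z hz)
  have hud : ∀ z ∈ ball (0 : ℂ) ρ, HasFDerivAt u (fderiv ℝ u z) z := fun z hz =>
    ((huρ.differentiableOn (by simp)).differentiableAt (isOpen_ball.mem_nhds hz)).hasFDerivAt
  have hΘd : ∀ z ∈ ball (0 : ℂ) ρ, HasFDerivAt Θ (fderiv ℝ Θ (u z)) (u z) := fun z hz =>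
    ((hΘ1.differentiableOn_one _ (husrc z hz)).differentiableAt
      (Θ.open_source.mem_nhds (husrc z hz))).hasFDerivAt
  have hGd : ∀ z ∈ ball (0 : ℂ) ρ, HasFDerivAt G ((fderiv ℝ Θ (u z)).comp (fderiv ℝ u z)) z :=
    fun z hz => (hΘd z hz).comp z (hud z hz)
  have hGfd : ∀ z ∈ ball (0 : ℂ) ρ, fderiv ℝ G z = (fderiv ℝ Θ (u z)).comp (fderiv ℝ u z) :=
    fun z hz => (hGd z hz).fderiv
  -- `G` is `J̃`-holomorphic
  have hGhol : ∀ z ∈ ball (0 : ℂ) ρ, fderiv ℝ G z I = Jt (G z) (fderiv ℝ G z 1) := by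
    intro z hz
    have hx : G z ∈ Θ.target := hGU hz
    have hsx : Θ.symm (G z) = u z := Θ.left_inv (husrc z hz)
    obtain ⟨-, h2⟩ := fderiv_comp_fderiv_symm Θ hΘ1 hΘs1 hx
    rw [hGfd z hz]
    simp only [hJt, ContinuousLinearMap.comp_apply, hsx]
    have h3 : fderiv ℝ Θ.symm (G z) (fderiv ℝ Θ (u z) (fderiv ℝ u z 1)) = fderiv ℝ u z 1 := by
      have := congrArg (fun L : F →L[ℝ] F => L (fderiv ℝ u z 1)) h2
      simpa [hsx] using this
    rw [h3, ← hhol z (ball_subset_ball hρR hz) 1, mul_one]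
  have hG0 : G 0 = 0 := hΘ0
  have hGz : ∀ z ∈ ball (0 : ℂ) ρ, G z = ((ξ z) ^ k, û (ξ z)) := fun z hz => (hrep z hz).2
  have hGnc : ∃ᶠ z in 𝓝 (0 : ℂ), G z ≠ G 0 := by
    have hev : ∀ᶠ z in 𝓝[≠] (0 : ℂ), G z ≠ G 0 := by
      filter_upwards [mem_nhdsWithin_of_mem_nhds (isOpen_ball.mem_nhds (mem_ball_self hρ)),
        self_mem_nhdsWithin] with z hz hz0
      rw [hG0, hGz z hz]
      intro h
      have h1 : (ξ z) ^ k = 0 := by simpa using congrArg Prod.fst h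
      have h2 : ξ z = 0 := (pow_eq_zero_iff hk.ne').1 h1
      have h3 : z = 0 := ξ.injOn (hξsrc hz) (hξsrc (mem_ball_self hρ)) (by rw [h2, hξ0])
      exact hz0 h3
    exact hev.frequently.filter_mono nhdsWithin_le_nhds
  -- ### the leading term of `G`
  have hfin : Module.finrank ℝ (ℂ × ℂ) = 2 * 2 := by
    rw [Module.finrank_prod, Complex.finrank_real_complex]
  obtain ⟨k', Φ, b, C, ρ', hk', hb, hρ', hρ'ρ, hΦJ, hval, hder⟩ :=
    jHolomorphic_leadingTerm hfin Θ.open_target hJt1 (fun x hx v => hJt2 x hx v) hρ hGs hGU hGhol hGnc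
  simp only [zero_add, hG0, sub_zero] at hval hder hΦJ
  -- the leading direction `t c = Φ⁻¹ (c • b)`
  set T : ℂ →L[ℝ] (ℂ × ℂ) := (Φ.symm : EuclideanSpace ℂ (Fin 2) →L[ℝ] ℂ × ℂ).comp
    (((ContinuousLinearMap.id ℂ ℂ).smulRight b).restrictScalars ℝ) with hT
  have hTapp : ∀ c : ℂ, T c = Φ.symm (c • b) := fun c => rfl
  have hTinj : Function.Injective T := by
    refine (injective_iff_map_eq_zero T).2 fun c hc => ?_
    rw [hTapp] at hc
    have : c • b = 0 := by simpa using hc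
    exact (smul_eq_zero.1 this).resolve_right hb
  obtain ⟨m, hm, hmle⟩ := exists_bound_below_of_injective' T hTinj
  have hTle : ∀ c : ℂ, ‖T c‖ ≤ ‖(Φ.symm : EuclideanSpace ℂ (Fin 2) →L[ℝ] ℂ × ℂ)‖ * ‖b‖ * ‖c‖ := by
    intro c
    rw [hTapp]
    calc ‖Φ.symm (c • b)‖ ≤ ‖(Φ.symm : EuclideanSpace ℂ (Fin 2) →L[ℝ] ℂ × ℂ)‖ * ‖c • b‖ :=
          (Φ.symm : EuclideanSpace ℂ (Fin 2) →L[ℝ] ℂ × ℂ).le_opNorm _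
      _ = _ := by rw [norm_smul]; ring
  set MΦ : ℝ := ‖(Φ.symm : EuclideanSpace ℂ (Fin 2) →L[ℝ] ℂ × ℂ)‖ with hMΦ
  have hC0 : 0 ≤ C := by
    obtain ⟨z, hz, hz0⟩ : ∃ z ∈ ball (0 : ℂ) ρ', z ≠ 0 := by
      refine ⟨((ρ' / 2 : ℝ) : ℂ), ?_, by exact_mod_cast (half_pos hρ').ne'⟩
      rw [mem_ball_zero_iff, Complex.norm_real, Real.norm_eq_abs, abs_of_pos (half_pos hρ')]
      exact half_lt_self hρ'
    have h3 := (norm_nonneg _).trans (hval z hz)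
    have h4 : 0 < ‖z‖ ^ (k' + 1) := pow_pos (norm_pos_iff.2 hz0) _
    exact le_of_mul_le_mul_right (by rwa [zero_mul]) h4
  -- the expansion `G z = T (z^k') + e z`, `‖e z‖ ≤ MΦ C |z|^(k'+1)`
  have hexp : ∀ z ∈ ball (0 : ℂ) ρ', ‖G z - T (z ^ k')‖ ≤ MΦ * C * ‖z‖ ^ (k' + 1) := by
    intro z hz
    have h1 : G z - T (z ^ k') = Φ.symm (Φ (G z) - z ^ k' • b) := by
      rw [map_sub, hTapp, ContinuousLinearEquiv.symm_apply_apply]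
    rw [h1]
    calc ‖Φ.symm (Φ (G z) - z ^ k' • b)‖ ≤ MΦ * ‖Φ (G z) - z ^ k' • b‖ :=
          (Φ.symm : EuclideanSpace ℂ (Fin 2) →L[ℝ] ℂ × ℂ).le_opNorm _
      _ ≤ MΦ * (C * ‖z‖ ^ (k' + 1)) := mul_le_mul_of_nonneg_left (hval z hz) (norm_nonneg _)
      _ = _ := by ring
  -- ### Lipschitz-type control of `ξ` and `ξ⁻¹` at `0`
  have hz0src : (0 : ℂ) ∈ ξ.source := hξsrc (mem_ball_self hρ)
  have h0tξ : (0 : ℂ) ∈ ξ.target := by rw [← hξ0]; exact ξ.map_source hz0src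
  have hξsymm0 : ξ.symm 0 = 0 := by
    have := ξ.left_inv hz0src; rwa [hξ0] at this
  have hξd0 : HasFDerivAt ξ (fderiv ℝ ξ 0) 0 :=
    ((hξ.differentiableOn_one _ hz0src).differentiableAt (ξ.open_source.mem_nhds hz0src)).hasFDerivAt
  have hξsd0 : HasFDerivAt ξ.symm (fderiv ℝ ξ.symm 0) 0 :=
    ((hξs.differentiableOn_one _ h0tξ).differentiableAt (ξ.open_target.mem_nhds h0tξ)).hasFDerivAt
  have hξO : (fun z => ξ z) =O[𝓝 0] fun z => z := by
    have := hξd0.isBigO_sub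
    simpa [hξ0] using this
  have hξsO : (fun w => ξ.symm w) =O[𝓝 0] fun w => w := by
    have := hξsd0.isBigO_sub
    simpa [hξsymm0] using this
  have hξt : Tendsto ξ (𝓝 0) (𝓝 0) := by
    have := hξd0.continuousAt.tendsto; rwa [hξ0] at this
  -- `z = O(ξ z)`
  have hzO : (fun z : ℂ => z) =O[𝓝 0] fun z => ξ z := by
    have h1 := hξsO.comp_tendsto hξt
    have h2 : (fun z => ξ.symm (ξ z)) =ᶠ[𝓝 0] fun z => z := by
      filter_upwards [ξ.open_source.mem_nhds hz0src] with z hz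
      exact ξ.left_inv hz
    exact (h1.congr' h2 EventuallyEq.rfl)
  -- `û (ξ z) = O(|z|^(k+1))`
  have hûξ : (fun z => û (ξ z)) =O[𝓝 0] fun z : ℂ => ‖z‖ ^ (k + 1) := by
    have h1 := hûO.comp_tendsto hξt
    have h2 : ((fun w : ℂ => ‖w‖ ^ (k + 1)) ∘ ξ) =O[𝓝 0] fun z : ℂ => ‖z‖ ^ (k + 1) := by
      obtain ⟨L₁, hL₁, hb⟩ := hξO.exists_pos
      refine IsBigO.of_bound (L₁ ^ (k + 1)) ?_
      filter_upwards [hb.bound] with z hz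
      simp only [Function.comp, Real.norm_of_nonneg (pow_nonneg (norm_nonneg _) _)]
      rw [← mul_pow]
      exact pow_le_pow_left₀ (norm_nonneg _) hz _
    exact h1.trans h2
  -- ### `k' = k`
  have hkk : k' = k := by
    -- lower and upper bounds for `‖G z‖`
    obtain ⟨L₂, hL₂, hL₂b⟩ := hzO.exists_pos
    obtain ⟨L₁, hL₁, hL₁b⟩ := hξO.exists_pos
    obtain ⟨Cu, hCu, hCub⟩ := hûξ.exists_pos
    have hball : ∀ᶠ z in 𝓝 (0 : ℂ), z ∈ ball (0 : ℂ) ρ' ∧ ‖z‖ ≤ 1 := by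
      filter_upwards [isOpen_ball.mem_nhds (mem_ball_self hρ'),
        Metric.closedBall_mem_nhds (0 : ℂ) one_pos] with z hz hz1
      exact ⟨hz, by simpa using hz1⟩
    -- (1) `c |z|^k ≤ ‖G z‖ ≤ C' |z|^k'`  ⇒  `k' ≤ k`
    have h1 : k' ≤ k := by
      refine le_of_pow_le_pow_nhds (c := (L₂ ^ k)⁻¹ / (MΦ * ‖b‖ + MΦ * C + 1)) (by positivity) ?_
      filter_upwards [hball.filter_mono nhdsWithin_le_nhds, hL₂b.bound.filter_mono nhdsWithin_le_nhds,
        self_mem_nhdsWithin] with z ⟨hz, hz1⟩ hzb hz0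
      have hzρ : z ∈ ball (0 : ℂ) ρ := ball_subset_ball hρ'ρ hz
      -- lower bound
      have hlow : (L₂ ^ k)⁻¹ * ‖z‖ ^ k ≤ ‖G z‖ := by
        have h2 : ‖z‖ ≤ L₂ * ‖ξ z‖ := hzb
        have h3 : ‖z‖ ^ k ≤ L₂ ^ k * ‖ξ z‖ ^ k := by
          rw [← mul_pow]; exact pow_le_pow_left₀ (norm_nonneg _) h2 k
        have h4 : ‖ξ z‖ ^ k ≤ ‖G z‖ := by
          rw [hGz z hzρ, ← norm_pow]; exact norm_fst_le ((((ξ z) ^ k, û (ξ z))) : ℂ × ℂ)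
        rw [inv_mul_le_iff₀ (by positivity)]
        exact h3.trans (mul_le_mul_of_nonneg_left h4 (by positivity))
      -- upper bound
      have hup : ‖G z‖ ≤ (MΦ * ‖b‖ + MΦ * C + 1) * ‖z‖ ^ k' := by
        have h2 := hexp z hz
        have h3 := hTle (z ^ k')
        rw [norm_pow] at h3
        have h4 := norm_sub_norm_le (G z) (T (z ^ k'))
        have h5 : ‖z‖ ^ (k' + 1) ≤ ‖z‖ ^ k' := by
          rw [pow_succ]; exact mul_le_of_le_one_right (by positivity) hz1
        have h6 : 0 ≤ ‖z‖ ^ k' := by positivity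
        nlinarith [mul_nonneg (mul_nonneg (norm_nonneg (Φ.symm : EuclideanSpace ℂ (Fin 2) →L[ℝ] ℂ × ℂ)) hC0) (sub_nonneg.2 h5)]
      rw [div_mul_eq_mul_div, div_le_iff₀ (by positivity)]
      calc (L₂ ^ k)⁻¹ * ‖z‖ ^ k ≤ ‖G z‖ := hlow
        _ ≤ (MΦ * ‖b‖ + MΦ * C + 1) * ‖z‖ ^ k' := hup
        _ = ‖z‖ ^ k' * (MΦ * ‖b‖ + MΦ * C + 1) := mul_comm _ _
    -- (2) `c |z|^k' ≤ ‖G z‖ ≤ C' |z|^k`  ⇒  `k ≤ k'`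
    have h2 : k ≤ k' := by
      have hsmall : ∀ᶠ z in 𝓝 (0 : ℂ), MΦ * C * ‖z‖ ≤ m / 2 := by
        have : Tendsto (fun z : ℂ => MΦ * C * ‖z‖) (𝓝 0) (𝓝 (MΦ * C * 0)) :=
          tendsto_const_nhds.mul (continuous_norm.tendsto' (0 : ℂ) 0 norm_zero)
        rw [mul_zero] at this
        exact this (Iic_mem_nhds (half_pos hm))
      refine le_of_pow_le_pow_nhds (c := (m / 2) / (L₁ ^ k + Cu + 1)) (by positivity) ?_
      filter_upwards [hball.filter_mono nhdsWithin_le_nhds, hL₁b.bound.filter_mono nhdsWithin_le_nhds,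
        hCub.bound.filter_mono nhdsWithin_le_nhds, hsmall.filter_mono nhdsWithin_le_nhds,
        self_mem_nhdsWithin] with z ⟨hz, hz1⟩ hzb hzu hzs hz0
      have hzρ : z ∈ ball (0 : ℂ) ρ := ball_subset_ball hρ'ρ hz
      -- lower bound
      have hlow : m / 2 * ‖z‖ ^ k' ≤ ‖G z‖ := by
        have h3 := hexp z hz
        have h4 := hmle (z ^ k')
        rw [norm_pow] at h4
        have h5 := norm_sub_norm_le (T (z ^ k')) (G z)
        rw [norm_sub_rev] at h5
        have h6 : MΦ * C * ‖z‖ ^ (k' + 1) ≤ m / 2 * ‖z‖ ^ k' := by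
          calc MΦ * C * ‖z‖ ^ (k' + 1) = MΦ * C * ‖z‖ * ‖z‖ ^ k' := by ring
            _ ≤ m / 2 * ‖z‖ ^ k' := mul_le_mul_of_nonneg_right hzs (by positivity)
        linarith
      -- upper bound
      have hup : ‖G z‖ ≤ (L₁ ^ k + Cu + 1) * ‖z‖ ^ k := by
        rw [hGz z hzρ, Prod.norm_def]
        have ha : ‖(ξ z) ^ k‖ ≤ L₁ ^ k * ‖z‖ ^ k := by
          rw [norm_pow, ← mul_pow]
          exact pow_le_pow_left₀ (norm_nonneg _) (by simpa using hzb) k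
        have hb' : ‖û (ξ z)‖ ≤ Cu * ‖z‖ ^ k := by
          have : ‖û (ξ z)‖ ≤ Cu * ‖z‖ ^ (k + 1) := by
            simpa [Real.norm_of_nonneg (pow_nonneg (norm_nonneg z) _)] using hzu
          refine this.trans (mul_le_mul_of_nonneg_left ?_ hCu.le)
          rw [pow_succ]; exact mul_le_of_le_one_right (by positivity) hz1
        have hpos : 0 ≤ ‖z‖ ^ k := by positivity
        refine max_le (ha.trans ?_) (hb'.trans ?_)
        · exact mul_le_mul_of_nonneg_right (by linarith only [hCu]) hpos
        · exact mul_le_mul_of_nonneg_right (by linarith only [pow_nonneg hL₁.le k]) hpos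
      rw [div_mul_eq_mul_div, div_le_iff₀ (by positivity)]
      calc m / 2 * ‖z‖ ^ k' ≤ ‖G z‖ := hlow
        _ ≤ (L₁ ^ k + Cu + 1) * ‖z‖ ^ k := hup
        _ = ‖z‖ ^ k * (L₁ ^ k + Cu + 1) := mul_comm _ _
    exact le_antisymm h1 h2
  subst hkk
  -- ### the leading direction is horizontal
  have hTdecomp : ∀ c : ℂ, T c = (c.re : ℝ) • Φ.symm b + (c.im : ℝ) • Φ.symm (I • b) := by
    intro c
    rw [hTapp]
    have : c • b = (c.re : ℝ) • b + (c.im : ℝ) • (I • b) := by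
      rw [← Complex.coe_smul, ← Complex.coe_smul, smul_smul, ← add_smul, re_add_im]
    rw [this, map_add, map_smul, map_smul]
  have hT2 : ∀ c : ℂ, (T c).2 = 0 := by
    have hO : (fun z : ℂ => (((z ^ k').re : ℝ) • (Φ.symm b).2 + ((z ^ k').im : ℝ) • (Φ.symm (I • b)).2))
        =O[𝓝 0] fun z : ℂ => ‖z‖ ^ (k' + 1) := by
      -- `(T (z^k)).2 = (G z).2 - (e z).2 = û (ξ z) - (e z).2`
      have h1 : (fun z : ℂ => (T (z ^ k')).2) =O[𝓝 0] fun z : ℂ => ‖z‖ ^ (k' + 1) := by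
        have h2 : (fun z : ℂ => G z - T (z ^ k')) =O[𝓝 0] fun z : ℂ => ‖z‖ ^ (k' + 1) := by
          refine IsBigO.of_bound (MΦ * C) ?_
          filter_upwards [isOpen_ball.mem_nhds (mem_ball_self hρ')] with z hz
          simpa [Real.norm_of_nonneg (pow_nonneg (norm_nonneg z) _)] using hexp z hz
        have h3 : (fun z : ℂ => (G z).2) =O[𝓝 0] fun z : ℂ => ‖z‖ ^ (k' + 1) := by
          refine hûξ.congr' ?_ EventuallyEq.rfl
          filter_upwards [isOpen_ball.mem_nhds (mem_ball_self hρ)] with z hz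
          rw [hGz z hz]
        have h4 : (fun z : ℂ => (G z - T (z ^ k')).2) =O[𝓝 0] fun z : ℂ => ‖z‖ ^ (k' + 1) := by
          refine (IsBigO.of_bound 1 ?_).trans h2
          exact Eventually.of_forall fun z => by simpa using norm_snd_le (G z - T (z ^ k'))
        have := h3.sub h4
        refine this.congr_left fun z => ?_
        simp
      refine h1.congr_left fun z => ?_
      rw [hTdecomp]; simp
    obtain ⟨hp, hq⟩ := eq_zero_of_powCoeff_isBigO hk' hO
    intro c
    rw [hTdecomp]
    simp [hp, hq]
  refine ⟨?_, ?_, ?_⟩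
  · -- ### (i) `k ≥ 2` when `du(0) = 0`
    intro hdu0
    by_contra hlt
    have hk1 : k' = 1 := by omega
    have h1 := hder 0 (mem_ball_self hρ')
    rw [norm_zero, zero_pow hk'.ne', mul_zero, norm_le_zero_iff] at h1
    -- the derivative of `z ↦ Φ (G z) - z • b` at `0` is `-(· • b)` since `dG(0) = 0`
    have hGd0 : HasFDerivAt G (0 : ℂ →L[ℝ] ℂ × ℂ) 0 := by
      have := hGd 0 (mem_ball_self hρ)
      rwa [hdu0, ContinuousLinearMap.comp_zero] at this
    have h2 : HasFDerivAt (fun z : ℂ => Φ (G z) - z ^ k' • b)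
        (-(((ContinuousLinearMap.id ℂ ℂ).smulRight b).restrictScalars ℝ)) 0 := by
      have ha : HasFDerivAt (fun z : ℂ => Φ (G z)) (0 : ℂ →L[ℝ] EuclideanSpace ℂ (Fin 2)) 0 := by
        have := (Φ : ℂ × ℂ →L[ℝ] EuclideanSpace ℂ (Fin 2)).hasFDerivAt.comp 0 hGd0
        rwa [ContinuousLinearMap.comp_zero] at this
      have hb' : HasFDerivAt (fun z : ℂ => z ^ k' • b)
          (((ContinuousLinearMap.id ℂ ℂ).smulRight b).restrictScalars ℝ) 0 := by
        rw [hk1]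
        simp only [pow_one]
        exact (((ContinuousLinearMap.id ℂ ℂ).smulRight b).hasFDerivAt).restrictScalars ℝ
      have := ha.sub hb'
      rwa [zero_sub] at this
    rw [h2.fderiv, neg_eq_zero] at h1
    have : b = 0 := by
      have := congrArg (fun L : ℂ →L[ℝ] EuclideanSpace ℂ (Fin 2) => L 1) h1
      simpa using this
    exact hb this
  · -- ### (ii) the horizontal line is `J̃(0)`-invariant
    intro x
    -- `x ↦ (T c).1` is surjective
    set T1 : ℂ →ₗ[ℝ] ℂ := (LinearMap.fst ℝ ℂ ℂ) ∘ₗ (T : ℂ →ₗ[ℝ] ℂ × ℂ) with hT1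
    have hT1inj : Function.Injective T1 := by
      refine (injective_iff_map_eq_zero T1).2 fun c hc => hTinj ?_
      rw [map_zero]
      exact Prod.ext (by simpa [hT1] using hc) (hT2 c)
    obtain ⟨c, hc⟩ := (LinearMap.injective_iff_surjective.1 hT1inj) x
    have hxT : ((x, 0) : ℂ × ℂ) = T c := Prod.ext (by simpa [hT1] using hc.symm) (by rw [hT2])
    -- `J̃(0) (T c) = T (i c)`
    have hJT : Jt 0 (T c) = T (I * c) := by
      apply Φ.injective
      rw [hΦJ (T c), hTapp, hTapp, ContinuousLinearEquiv.apply_symm_apply,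
        ContinuousLinearEquiv.apply_symm_apply, smul_smul]
    change (Jt 0 (x, 0)).2 = 0
    rw [hxT, hJT, hT2]
  · -- ### (iii) `dû = O(|w|^k)`
    -- the derivative expansion of `G`
    have hdexp : ∀ z ∈ ball (0 : ℂ) ρ', ∀ v : ℂ,
        ‖(fderiv ℝ G z v).2‖ ≤ MΦ * C * ‖z‖ ^ k' * ‖v‖ := by
      intro z hz v
      have hzρ : z ∈ ball (0 : ℂ) ρ := ball_subset_ball hρ'ρ hz
      have ha : HasFDerivAt (fun z : ℂ => Φ (G z))
          ((Φ : ℂ × ℂ →L[ℝ] EuclideanSpace ℂ (Fin 2)).comp (fderiv ℝ G z)) z :=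
        (Φ : ℂ × ℂ →L[ℝ] EuclideanSpace ℂ (Fin 2)).hasFDerivAt.comp z (hGd z hzρ).differentiableAt.hasFDerivAt
      have hb' := ((hasDerivAt_pow k' z).hasFDerivAt.smul_const b).restrictScalars ℝ
      have hsplit : fderiv ℝ (fun z : ℂ => Φ (G z) - z ^ k' • b) z v =
          Φ (fderiv ℝ G z v) - (v * ((k' : ℂ) * z ^ (k' - 1))) • b := by
        have hsub : HasFDerivAt (fun z : ℂ => Φ (G z) - z ^ k' • b) _ z := ha.sub hb'
        rw [hsub.fderiv]
        simp
      have h2 : ‖Φ (fderiv ℝ G z v) - (v * ((k' : ℂ) * z ^ (k' - 1))) • b‖ ≤ C * ‖z‖ ^ k' * ‖v‖ := by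
        rw [← hsplit]
        exact (ContinuousLinearMap.le_opNorm _ v).trans
          (mul_le_mul_of_nonneg_right (hder z hz) (norm_nonneg v))
      -- `Φ (dG v) = (k z^(k-1) v) • b + Er`
      set Er : EuclideanSpace ℂ (Fin 2) :=
        Φ (fderiv ℝ G z v) - (v * ((k' : ℂ) * z ^ (k' - 1))) • b with hEr
      have h3 : fderiv ℝ G z v = T (v * ((k' : ℂ) * z ^ (k' - 1))) + Φ.symm Er := by
        have : Φ (fderiv ℝ G z v) = (v * ((k' : ℂ) * z ^ (k' - 1))) • b + Er := by
          rw [hEr, add_sub_cancel]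
        rw [hTapp, ← map_add, ← this, ContinuousLinearEquiv.symm_apply_apply]
      rw [h3, Prod.snd_add, hT2, zero_add]
      calc ‖(Φ.symm Er).2‖ ≤ ‖Φ.symm Er‖ := norm_snd_le _
        _ ≤ MΦ * ‖Er‖ := (Φ.symm : EuclideanSpace ℂ (Fin 2) →L[ℝ] ℂ × ℂ).le_opNorm _
        _ ≤ MΦ * (C * ‖z‖ ^ k' * ‖v‖) := mul_le_mul_of_nonneg_left h2 (norm_nonneg _)
        _ = _ := by ring
    -- `û = (G ∘ ξ⁻¹).2` near `0`
    have hO' : ∀ᶠ w in 𝓝 (0 : ℂ), w ∈ ξ.target ∧ ξ.symm w ∈ ball (0 : ℂ) ρ' := by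
      have h1 : ContinuousAt ξ.symm 0 := hξsd0.continuousAt
      have h2 := h1.preimage_mem_nhds
        (isOpen_ball.mem_nhds (show ξ.symm 0 ∈ ball (0 : ℂ) ρ' by rw [hξsymm0]; exact mem_ball_self hρ'))
      filter_upwards [ξ.open_target.mem_nhds h0tξ, h2] with w hw1 hw2
      exact ⟨hw1, hw2⟩
    have hûeq : û =ᶠ[𝓝 0] fun w => (G (ξ.symm w)).2 := by
      filter_upwards [hO'] with w ⟨hw1, hw2⟩
      rw [hGz _ (ball_subset_ball hρ'ρ hw2), ξ.right_inv hw1]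
    -- derivative of the composite
    have hcomp : ∀ᶠ w in 𝓝 (0 : ℂ), fderiv ℝ û w =
        (ContinuousLinearMap.snd ℝ ℂ ℂ).comp ((fderiv ℝ G (ξ.symm w)).comp (fderiv ℝ ξ.symm w)) := by
      have hO'' : ∀ᶠ w in 𝓝 (0 : ℂ), ∀ᶠ w' in 𝓝 w, w' ∈ ξ.target ∧ ξ.symm w' ∈ ball (0 : ℂ) ρ' :=
        (eventually_eventually_nhds).2 hO'
      filter_upwards [hO', hO''] with w ⟨hw1, hw2⟩ hw'
      have hloc : û =ᶠ[𝓝 w] fun w => (G (ξ.symm w)).2 := by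
        filter_upwards [hw'] with w' ⟨h1, h2⟩
        rw [hGz _ (ball_subset_ball hρ'ρ h2), ξ.right_inv h1]
      rw [hloc.fderiv_eq]
      have hd1 : HasFDerivAt ξ.symm (fderiv ℝ ξ.symm w) w :=
        ((hξs.differentiableOn_one _ hw1).differentiableAt (ξ.open_target.mem_nhds hw1)).hasFDerivAt
      have hd2 : HasFDerivAt G (fderiv ℝ G (ξ.symm w)) (ξ.symm w) :=
        (hGd _ (ball_subset_ball hρ'ρ hw2)).differentiableAt.hasFDerivAt
      exact ((hasFDerivAt_snd (𝕜 := ℝ) (E := ℂ) (F := ℂ)).comp w (hd2.comp w hd1)).fderiv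
    -- bounds for `ξ⁻¹` and its derivative near `0`
    obtain ⟨L₃, hL₃, hL₃b⟩ := hξsO.exists_pos
    have hdξs : ∀ᶠ w in 𝓝 (0 : ℂ), ‖fderiv ℝ ξ.symm w‖ ≤ ‖fderiv ℝ ξ.symm 0‖ + 1 := by
      have hc : ContinuousAt (fderiv ℝ ξ.symm) 0 :=
        (hξs.continuousOn_fderiv_of_isOpen ξ.open_target le_rfl).continuousAt
          (ξ.open_target.mem_nhds h0tξ)
      have := (continuous_norm.continuousAt.comp hc).eventually (Iio_mem_nhds (lt_add_one _))
      exact this.mono fun w hw => le_of_lt hw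
    refine IsBigO.of_bound (MΦ * C * L₃ ^ k' * (‖fderiv ℝ ξ.symm 0‖ + 1)) ?_
    filter_upwards [hcomp, hO', hL₃b.bound, hdξs] with w hw ⟨hw1, hw2⟩ hwL hwd
    rw [hw, Real.norm_of_nonneg (pow_nonneg (norm_nonneg w) _)]
    refine ContinuousLinearMap.opNorm_le_bound _ (by positivity) fun v => ?_
    simp only [ContinuousLinearMap.comp_apply, ContinuousLinearMap.coe_snd']
    have h1 := hdexp (ξ.symm w) hw2 (fderiv ℝ ξ.symm w v)
    have h2 : ‖fderiv ℝ ξ.symm w v‖ ≤ (‖fderiv ℝ ξ.symm 0‖ + 1) * ‖v‖ :=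
      (ContinuousLinearMap.le_opNorm _ v).trans (mul_le_mul_of_nonneg_right hwd (norm_nonneg v))
    have h3 : ‖ξ.symm w‖ ^ k' ≤ L₃ ^ k' * ‖w‖ ^ k' := by
      rw [← mul_pow]; exact pow_le_pow_left₀ (norm_nonneg _) (by simpa using hwL) k'
    have h4 : 0 ≤ MΦ * C := by positivity
    calc ‖(fderiv ℝ G (ξ.symm w) (fderiv ℝ ξ.symm w v)).2‖
        ≤ MΦ * C * ‖ξ.symm w‖ ^ k' * ‖fderiv ℝ ξ.symm w v‖ := h1
      _ ≤ MΦ * C * (L₃ ^ k' * ‖w‖ ^ k') * ((‖fderiv ℝ ξ.symm 0‖ + 1) * ‖v‖) := by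
          gcongr
      _ = MΦ * C * L₃ ^ k' * (‖fderiv ℝ ξ.symm 0‖ + 1) * ‖w‖ ^ k' * ‖v‖ := by ring

/-! ### Curves read in the two charts -/

/-- **A curve read in the charts `Θ` (target) and `ξ` (domain): chain rule.** [folklore] -/
theorem chartCurve_hasFDerivAt {X : Type*} [NormedAddCommGroup X] [NormedSpace ℝ X]
    (Θ : OpenPartialHomeomorph X (ℂ × ℂ)) (hΘ : ContDiffOn ℝ 1 Θ Θ.source)
    (ξ : OpenPartialHomeomorph ℂ ℂ) (hξs : ContDiffOn ℝ 1 ξ.symm ξ.target)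
    {h : ℂ → X} {w : ℂ} (hw : w ∈ ξ.target) (hhd : DifferentiableAt ℝ h (ξ.symm w))
    (hsrc : h (ξ.symm w) ∈ Θ.source) :
    HasFDerivAt (fun w => Θ (h (ξ.symm w)))
      ((fderiv ℝ Θ (h (ξ.symm w))).comp ((fderiv ℝ h (ξ.symm w)).comp (fderiv ℝ ξ.symm w))) w := by
  have hdΘ : HasFDerivAt Θ (fderiv ℝ Θ (h (ξ.symm w))) (h (ξ.symm w)) :=
    ((hΘ.differentiableOn_one _ hsrc).differentiableAt (Θ.open_source.mem_nhds hsrc)).hasFDerivAt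
  have hdS : HasFDerivAt ξ.symm (fderiv ℝ ξ.symm w) w :=
    ((hξs.differentiableOn_one _ hw).differentiableAt (ξ.open_target.mem_nhds hw)).hasFDerivAt
  exact hdΘ.comp w (hhd.hasFDerivAt.comp w hdS)

/-- **A curve read in the charts `Θ` (target) and `ξ` (domain): the tangent line.** For a map `h`
which is `J`-holomorphic at `y = ξ⁻¹ w` with `h y` in the source of `Θ` and `dh(y)` injective, the
differential `DΘ(h y) ∘ dh(y) ∘ D(ξ⁻¹)(w)` of `Θ ∘ h ∘ ξ⁻¹` at `w` is injective and its image is a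
complex line for the transported structure `J̃ = DΘ ∘ J ∘ DΘ⁻¹` at `Θ (h y)`. [folklore] -/
theorem chartCurve_injective_invariant {X : Type*} [NormedAddCommGroup X] [NormedSpace ℝ X]
    {J : X → X →L[ℝ] X} (Θ : OpenPartialHomeomorph X (ℂ × ℂ)) (hΘ : ContDiffOn ℝ 1 Θ Θ.source)
    (hΘs : ContDiffOn ℝ 1 Θ.symm Θ.target) (ξ : OpenPartialHomeomorph ℂ ℂ)
    (hξ : ContDiffOn ℝ 1 ξ ξ.source) (hξs : ContDiffOn ℝ 1 ξ.symm ξ.target)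
    {h : ℂ → X} {w : ℂ} (hw : w ∈ ξ.target) (hsrc : h (ξ.symm w) ∈ Θ.source)
    (hhol : ∀ α : ℂ, fderiv ℝ h (ξ.symm w) (I * α) = J (h (ξ.symm w)) (fderiv ℝ h (ξ.symm w) α))
    (hinj : Function.Injective (fderiv ℝ h (ξ.symm w))) :
    Function.Injective
        ((fderiv ℝ Θ (h (ξ.symm w))).comp ((fderiv ℝ h (ξ.symm w)).comp (fderiv ℝ ξ.symm w))) ∧
      ∀ c : ℂ,
        ((fderiv ℝ Θ (Θ.symm (Θ (h (ξ.symm w))))).comp ((J (Θ.symm (Θ (h (ξ.symm w))))).comp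
          (fderiv ℝ Θ.symm (Θ (h (ξ.symm w))))))
          (((fderiv ℝ Θ (h (ξ.symm w))).comp ((fderiv ℝ h (ξ.symm w)).comp (fderiv ℝ ξ.symm w))) c) ∈
        LinearMap.range (((fderiv ℝ Θ (h (ξ.symm w))).comp
          ((fderiv ℝ h (ξ.symm w)).comp (fderiv ℝ ξ.symm w)) : ℂ →L[ℝ] ℂ × ℂ) : ℂ →ₗ[ℝ] ℂ × ℂ) := by
  set y := ξ.symm w with hy
  set P : X →L[ℝ] ℂ × ℂ := fderiv ℝ Θ (h y) with hP
  set D : ℂ →L[ℝ] X := fderiv ℝ h y with hD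
  set S : ℂ →L[ℝ] ℂ := fderiv ℝ ξ.symm w with hS
  have hx : Θ (h y) ∈ Θ.target := Θ.map_source hsrc
  have hsx : Θ.symm (Θ (h y)) = h y := Θ.left_inv hsrc
  obtain ⟨hξ1, hξ2⟩ := fderiv_comp_fderiv_symm ξ hξ hξs hw
  obtain ⟨-, hΘ2⟩ := fderiv_comp_fderiv_symm Θ hΘ hΘs hx
  rw [hsx] at hΘ2
  -- the inverse of `S`
  set σ : ℂ ≃L[ℝ] ℂ := ContinuousLinearEquiv.equivOfInverse S (fderiv ℝ ξ y)
    (fun c => by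
      have := congrArg (fun L : ℂ →L[ℝ] ℂ => L c) hξ1
      simpa using this)
    (fun c => by
      have := congrArg (fun L : ℂ →L[ℝ] ℂ => L c) hξ2
      simpa using this) with hσ
  have hσS : (σ : ℂ →L[ℝ] ℂ) = S := rfl
  refine ⟨?_, fun c => ?_⟩
  · -- injectivity: `P` has a left inverse, `D` is injective, `S` is invertible
    intro c₁ c₂ heq
    simp only [ContinuousLinearMap.comp_apply] at heq
    have h1 : D (S c₁) = D (S c₂) := by
      have := congrArg (fderiv ℝ Θ.symm (Θ (h y))) heq
      have e1 := congrArg (fun L : X →L[ℝ] X => L (D (S c₁))) hΘ2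
      have e2 := congrArg (fun L : X →L[ℝ] X => L (D (S c₂))) hΘ2
      simp only [ContinuousLinearMap.comp_apply, ContinuousLinearMap.id_apply] at e1 e2
      rwa [e1, e2] at this
    have h2 : S c₁ = S c₂ := hinj h1
    exact σ.injective h2
  · rw [← hσS]
    rw [hsx]
    exact transported_range_invariant (J := J (h y)) (D := D) hhol hΘ2 σ c

/-! ### The cusp double-point theorem from the representation formula -/

/-- **Operator-norm bookkeeping for the `C¹`-closeness of `Θ ∘ f'ₙ ∘ ξ⁻¹`.** For bounded linear
maps `A, A' : X₃ → X₄`, `B, B' : X₂ → X₃`, `T : X₁ → X₂` with `‖A‖ ≤ M_A`, `‖B'‖ ≤ M_B + 1`,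
`‖T‖ ≤ M_S` and the tolerances `‖A' - A‖ ≤ δ / (2 (M_B + 1) (M_S + 1))`,
`‖B' - B‖ ≤ δ / (2 (M_A + 1) (M_S + 1))`, one has `‖A' ∘ B' ∘ T - A ∘ B ∘ T‖ ≤ δ`
(write the difference as `((A' - A) ∘ B' + A ∘ (B' - B)) ∘ T`). Extracted from the proof of
`cusp_doublePoints_of_representationFormula` (step (b)) to keep that proof within the default
heartbeat budget. [folklore] -/
theorem opNorm_comp_comp_sub_le_of_tolerances {X₁ X₂ X₃ X₄ : Type*}
    [NormedAddCommGroup X₁] [NormedSpace ℝ X₁] [NormedAddCommGroup X₂] [NormedSpace ℝ X₂]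
    [NormedAddCommGroup X₃] [NormedSpace ℝ X₃] [NormedAddCommGroup X₄] [NormedSpace ℝ X₄]
    (A A' : X₃ →L[ℝ] X₄) (B B' : X₂ →L[ℝ] X₃) (T : X₁ →L[ℝ] X₂) {δ MA MB MS : ℝ}
    (hδ : 0 ≤ δ) (hMA : 0 ≤ MA) (hMB : 0 ≤ MB) (hMS : 0 ≤ MS)
    (hA'A : ‖A' - A‖ ≤ δ / (2 * (MB + 1) * (MS + 1)))
    (hB'B : ‖B' - B‖ ≤ δ / (2 * (MA + 1) * (MS + 1)))
    (hAn : ‖A‖ ≤ MA) (hB'n : ‖B'‖ ≤ MB + 1) (hTn : ‖T‖ ≤ MS) :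
    ‖A'.comp (B'.comp T) - A.comp (B.comp T)‖ ≤ δ := by
  have hdec : A'.comp (B'.comp T) - A.comp (B.comp T) =
      ((A' - A).comp B' + A.comp (B' - B)).comp T := by
    ext1 c
    simp
  rw [hdec]
  have hε : 0 ≤ δ / (2 * (MB + 1) * (MS + 1)) := by positivity
  calc ‖((A' - A).comp B' + A.comp (B' - B)).comp T‖
      ≤ ‖(A' - A).comp B' + A.comp (B' - B)‖ * ‖T‖ := ContinuousLinearMap.opNorm_comp_le _ _
    _ ≤ (‖A' - A‖ * ‖B'‖ + ‖A‖ * ‖B' - B‖) * ‖T‖ := by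
        gcongr
        exact (norm_add_le _ _).trans (add_le_add (ContinuousLinearMap.opNorm_comp_le _ _)
          (ContinuousLinearMap.opNorm_comp_le _ _))
    _ ≤ (δ / (2 * (MB + 1) * (MS + 1)) * (MB + 1) + MA * (δ / (2 * (MA + 1) * (MS + 1)))) * MS := by
        gcongr
    _ ≤ δ := by
        have h1 : δ / (2 * (MB + 1) * (MS + 1)) * (MB + 1) = δ / 2 / (MS + 1) := by
          field_simp
        have h2 : MA * (δ / (2 * (MA + 1) * (MS + 1))) ≤ δ / 2 / (MS + 1) := by
          rw [div_div, show MA * (δ / (2 * (MA + 1) * (MS + 1))) =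
            (MA / (MA + 1)) * (δ / (2 * (MS + 1))) by field_simp]
          have : MA / (MA + 1) ≤ 1 := (div_le_one (by positivity)).2 (by linarith)
          calc MA / (MA + 1) * (δ / (2 * (MS + 1))) ≤ 1 * (δ / (2 * (MS + 1))) := by
                gcongr
            _ = δ / (2 * (MS + 1)) := one_mul _
        have h3 : (δ / 2 / (MS + 1) + δ / 2 / (MS + 1)) * MS ≤ δ := by
          rw [← add_div, add_halves, div_mul_eq_mul_div, div_le_iff₀ (by positivity)]
          nlinarith
        calc (δ / (2 * (MB + 1) * (MS + 1)) * (MB + 1) + MA * (δ / (2 * (MA + 1) * (MS + 1)))) * MS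
            ≤ (δ / 2 / (MS + 1) + δ / 2 / (MS + 1)) * MS := by
              rw [h1]
              exact mul_le_mul_of_nonneg_right (add_le_add le_rfl h2) hMS
          _ ≤ δ := h3

/-- **McDuff's Theorem 1.1 on the immersed locus, from Wendl's representation formula.**
Assume the representation formula of [Wendl2020, Thm B.23] with its branch comparison (B.12)
(the hypothesis `hX`, in the form used by
`Literature.Geometry.Symplectic.jHolomorphic_localBranchDichotomy_of_representationFormula`).
Then for a smooth almost complex structure `J'` on `ℝ⁴`, a `J'`-holomorphic disc `f`, injective
on `|z| ≤ r`, immersed there except for a genuine critical point at the centre (`df(0) = 0`),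
is NOT a `C¹_loc`-limit on `|z| ≤ r` of injective immersed `J'`-holomorphic discs: all but
finitely many members of such a sequence have a double point in `|z| ≤ r`.
Proof: B.23 puts `f` in the chart form `w ↦ (wᵏ, û(w))`, `w = ξ(z)`, `k ≥ 2`
(`chart_tangent_data`); injectivity of `f` excludes the rotation-invariant alternative of `hX`
(`localBranch_partners_of_rotationInvariant`), so every branch pair is aligned; the
transported structure preserves the cusp's tangent line and `dû = O(|w|ᵏ)`
(`chart_tangent_data`); now `not_injOn_of_chartCusp` applies to `Θ ∘ f'ₙ ∘ ξ⁻¹` for `n ≫ 0`.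
[cite: McDuff1991LocalBehaviour, Thm 1.1, Lemma 1.4, Thm 1.5 and §2 (2.6)–(2.7);
Wendl2020, App. B, Thm B.23, Ex. B.25, Thm B.34] -/
theorem cusp_doublePoints_of_representationFormula
    (hX : ∀ (F : Type) [NormedAddCommGroup F] [NormedSpace ℝ F] [FiniteDimensional ℝ F],
      Module.finrank ℝ F = 4 →
      ∀ (J : F → F →L[ℝ] F) (U : Set F), IsOpen U → ContDiffOn ℝ ∞ J U →
        (∀ x ∈ U, ∀ v : F, J x (J x v) = -v) →
      ∀ (u : ℂ → F) (z₀ : ℂ) (R : ℝ), 0 < R → ContDiffOn ℝ ∞ u (ball z₀ R) →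
        MapsTo u (ball z₀ R) U →
        (∀ z ∈ ball z₀ R, ∀ α : ℂ, fderiv ℝ u z (Complex.I * α) = J (u z) (fderiv ℝ u z α)) →
        (∃ᶠ z in 𝓝 z₀, u z ≠ u z₀) →
        ∃ (k : ℕ) (Θ : OpenPartialHomeomorph F (ℂ × ℂ)) (ξ : OpenPartialHomeomorph ℂ ℂ)
          (uhat : ℂ → ℂ) (ρ ρ₁ : ℝ),
          0 < k ∧ 0 < ρ ∧ 0 < ρ₁ ∧
          u z₀ ∈ Θ.source ∧ Θ (u z₀) = 0 ∧ ContDiffOn ℝ ∞ Θ Θ.source ∧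
            ContDiffOn ℝ ∞ Θ.symm Θ.target ∧
          ball z₀ ρ ⊆ ξ.source ∧ ξ z₀ = 0 ∧ ContDiffOn ℝ 1 ξ ξ.source ∧
            ContDiffOn ℝ 1 ξ.symm ξ.target ∧ ContDiffOn ℝ ∞ ξ (ξ.source \ {z₀}) ∧
          MapsTo ξ (ball z₀ ρ) (ball 0 ρ₁) ∧ ContDiffOn ℝ 1 uhat (ball 0 ρ₁) ∧
            (uhat =O[𝓝 0] fun w : ℂ => ‖w‖ ^ (k + 1)) ∧
            (∀ z ∈ ball z₀ ρ, u z ∈ Θ.source ∧ Θ (u z) = ((ξ z) ^ k, uhat (ξ z))) ∧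
          ∀ ℓ : ℕ,
            (∀ᶠ w in 𝓝 (0 : ℂ),
              uhat (Complex.exp (2 * Real.pi * Complex.I * (ℓ / k : ℂ)) * w) = uhat w) ∨
            ∃ (m : ℕ) (C : ℂ), k < m ∧ C ≠ 0 ∧
              (fun w : ℂ =>
                  uhat (Complex.exp (2 * Real.pi * Complex.I * (ℓ / k : ℂ)) * w) - uhat w -
                    C * w ^ m)
                =o[𝓝 (0 : ℂ)] fun w : ℂ => ‖w‖ ^ m) :
    ∀ (J' : EuclideanSpace ℝ (Fin 4) → EuclideanSpace ℝ (Fin 4) →L[ℝ] EuclideanSpace ℝ (Fin 4)),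
      ContDiff ℝ ∞ J' → (∀ x v, J' x (J' x v) = -v) →
      ∀ (f : ℂ → EuclideanSpace ℝ (Fin 4)) (r R : ℝ), 0 < r → r < R →
        ContDiffOn ℝ ∞ f (ball 0 R) →
        (∀ z ∈ ball (0 : ℂ) R, ∀ ζ : ℂ, fderiv ℝ f z (Complex.I * ζ) = J' (f z) (fderiv ℝ f z ζ)) →
        InjOn f (closedBall 0 r) →
        (∀ z ∈ closedBall (0 : ℂ) r, z ≠ 0 → Injective (fderiv ℝ f z)) →
        fderiv ℝ f 0 = 0 →
        ∀ f' : ℕ → ℂ → EuclideanSpace ℝ (Fin 4), (∀ n, ContDiffOn ℝ ∞ (f' n) (ball 0 R)) →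
          (∀ n, ∀ z ∈ ball (0 : ℂ) R, ∀ ζ : ℂ,
              fderiv ℝ (f' n) z (Complex.I * ζ) = J' (f' n z) (fderiv ℝ (f' n) z ζ)) →
          (∀ n, ∀ z ∈ closedBall (0 : ℂ) r, Injective (fderiv ℝ (f' n) z)) →
          TendstoUniformlyOn f' f atTop (closedBall 0 r) →
          TendstoUniformlyOn (fun n => fderiv ℝ (f' n)) (fderiv ℝ f) atTop (closedBall 0 r) →
          ∀ᶠ n in atTop, ¬ InjOn (f' n) (closedBall 0 r) := by
  intro J' hJ' hJ'2 f r R hr hrR hf hfJ hfinj hfimm hf0 f' hf' hf'J hf'imm hC0 hC1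
  classical
  have hRpos : 0 < R := hr.trans hrR
  -- ### Step 1: `f` is not locally constant at `0`; apply the representation formula
  have hnc : ∃ᶠ z in 𝓝 (0 : ℂ), f z ≠ f 0 := by
    have hev : ∀ᶠ z in 𝓝[≠] (0 : ℂ), f z ≠ f 0 := by
      filter_upwards [mem_nhdsWithin_of_mem_nhds (closedBall_mem_nhds (0 : ℂ) hr),
        self_mem_nhdsWithin] with z hz hz0
      exact fun h => hz0 (hfinj hz (mem_closedBall_self hr.le) h)
    exact hev.frequently.filter_mono nhdsWithin_le_nhds
  have hfin : Module.finrank ℝ (EuclideanSpace ℝ (Fin 4)) = 4 := by simp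
  obtain ⟨k, Θ, ξ, û, ρ, ρ₁, hk, hρ, hρ₁, h0src, hΘ0, hΘ, hΘs, hξsrc, hξ0, hξ, hξs, -, hξρ, hû,
      hûO, hrep, hdich⟩ :=
    hX (EuclideanSpace ℝ (Fin 4)) hfin J' univ isOpen_univ hJ'.contDiffOn (fun x _ v => hJ'2 x v)
      f 0 R hRpos hf (mapsTo_univ _ _) hfJ hnc
  -- ### Step 2: tangent data
  set ρ₀ : ℝ := min ρ R with hρ₀_def
  have hρ₀ : 0 < ρ₀ := lt_min hρ hRpos
  have hρ₀R : ρ₀ ≤ R := min_le_right _ _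
  have hρ₀ρ : ρ₀ ≤ ρ := min_le_left _ _
  have hrep₀ : ∀ z ∈ ball (0 : ℂ) ρ₀, f z ∈ Θ.source ∧ Θ (f z) = ((ξ z) ^ k, û (ξ z)) :=
    fun z hz => hrep z (ball_subset_ball hρ₀ρ hz)
  have hξsrc₀ : ball 0 ρ₀ ⊆ ξ.source := (ball_subset_ball hρ₀ρ).trans hξsrc
  obtain ⟨hk2', hH, hdû⟩ := chart_tangent_data hJ' hJ'2 hf hfJ hk hρ₀ hρ₀R hΘ0 hΘ hΘs hξsrc₀
    hξ0 hξ hξs hûO hrep₀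
  have hk2 : 2 ≤ k := hk2' hf0
  -- ### Step 3: all branch pairs are aligned (injectivity of `f`)
  set S : Finset ℂ := (Polynomial.nthRootsFinset k (1 : ℂ)).erase 1 with hS_def
  have hal : ∀ μ ∈ S, ∃ (m : ℕ) (C : ℂ), k < m ∧ C ≠ 0 ∧
      (fun w : ℂ => û (μ * w) - û w - C * w ^ m) =o[𝓝 (0 : ℂ)] fun w : ℂ => ‖w‖ ^ m := by
    intro μ hμ
    obtain ⟨hμ1, hμmem⟩ := Finset.mem_erase.1 hμ
    have hμk : μ ^ k = 1 := (Polynomial.mem_nthRootsFinset hk (1 : ℂ)).1 hμmem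
    haveI : NeZero k := ⟨hk.ne'⟩
    obtain ⟨ℓ, -, hℓ⟩ := (Complex.isPrimitiveRoot_exp k hk.ne').eq_pow_of_pow_eq_one hμk
    have hμeq : Complex.exp (2 * Real.pi * Complex.I * (ℓ / k : ℂ)) = μ := by
      rw [← hℓ, ← Complex.exp_nat_mul]; congr 1; ring
    rcases hdich ℓ with hinv | ⟨m, C, hm, hC, ho⟩
    · exfalso
      simp only [hμeq] at hinv
      obtain ⟨r', hr', hpart⟩ :=
        localBranch_partners_of_rotationInvariant hρ hξsrc hξ0 hrep hμk hμ1 hinv r hr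
      have htpos : 0 < min r' r / 2 := half_pos (lt_min hr' hr)
      set t : ℂ := ((min r' r / 2 : ℝ) : ℂ) with ht_def
      have htn : ‖t‖ = min r' r / 2 := by
        rw [ht_def, Complex.norm_real, Real.norm_eq_abs, abs_of_pos htpos]
      have ht0 : t ≠ 0 := norm_pos_iff.1 (by rw [htn]; exact htpos)
      have htr' : t ∈ ball (0 : ℂ) r' := by
        rw [mem_ball_zero_iff, htn]; linarith [min_le_left r' r]
      have htr : t ∈ closedBall (0 : ℂ) r := by
        rw [mem_closedBall_zero_iff, htn]; linarith [min_le_right r' r]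
      obtain ⟨s, hs, hst, hfs⟩ := hpart t htr' ht0
      exact hst (hfinj (ball_subset_closedBall hs) htr hfs)
    · refine ⟨m, C, hm, hC, ?_⟩
      simpa only [hμeq] using ho
  choose! mS CS hmS hCS hoS using hal
  have hm' : ∀ μ ∈ S, k - 1 ≤ mS μ := fun μ hμ => by have := hmS μ hμ; omega
  have halign : ∀ μ ∈ S,
      (fun w => û w - û (μ * w) + CS μ * w ^ mS μ) =o[𝓝 0] fun w => ‖w‖ ^ mS μ := by
    intro μ hμ
    refine ((hoS μ hμ).neg_left).congr_left fun w => ?_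
    ring
  have hsum : ((k - 1 : ℕ) : ℤ) < ∑ μ ∈ S, (mS μ : ℤ) := by
    have hcard : S.card = k - 1 := by
      rw [hS_def, Finset.card_erase_of_mem ((Polynomial.mem_nthRootsFinset hk (1 : ℂ)).2 (one_pow k)),
        (Complex.isPrimitiveRoot_exp k hk.ne').card_nthRootsFinset]
    have h1 : ∑ μ ∈ S, ((k : ℤ) + 1) ≤ ∑ μ ∈ S, (mS μ : ℤ) :=
      Finset.sum_le_sum fun μ hμ => by have := hmS μ hμ; omega
    rw [Finset.sum_const, hcard, nsmul_eq_mul] at h1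
    have h2 : ((k - 1 : ℕ) : ℤ) < ((k - 1 : ℕ) : ℤ) * ((k : ℤ) + 1) := by
      have h3 : (1 : ℤ) ≤ ((k - 1 : ℕ) : ℤ) := by omega
      have h4 : (2 : ℤ) ≤ (k : ℤ) + 1 := by omega
      nlinarith
    exact h2.trans_le h1
  -- ### Step 4: the transported structure
  have hΘ1 : ContDiffOn ℝ 1 Θ Θ.source := hΘ.of_le (by norm_cast)
  have hΘs1 : ContDiffOn ℝ 1 Θ.symm Θ.target := hΘs.of_le (by norm_cast)
  obtain ⟨hJtc, hJt2⟩ := transportedStructure_props Θ hΘ1 hΘs1 hJ'.continuous hJ'2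
  have h0tgt : (0 : ℂ × ℂ) ∈ Θ.target := by rw [← hΘ0]; exact Θ.map_source h0src
  -- ### Step 5: the chart domain `U ∋ 0` (inside `ξ.target`, read back into `|z| < ρ₂`)
  have hz0src : (0 : ℂ) ∈ ξ.source := hξsrc (mem_ball_self hρ)
  have h0tξ : (0 : ℂ) ∈ ξ.target := by rw [← hξ0]; exact ξ.map_source hz0src
  have hξsymm0 : ξ.symm 0 = 0 := by have := ξ.left_inv hz0src; rwa [hξ0] at this
  set ρ₂ : ℝ := min ρ₀ r / 2 with hρ₂_def
  have hρ₂ : 0 < ρ₂ := half_pos (lt_min hρ₀ hr)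
  have hρ₂ρ₀ : ρ₂ < ρ₀ := by
    have := min_le_left ρ₀ r; rw [hρ₂_def]; linarith [lt_min hρ₀ hr]
  have hρ₂r : ρ₂ < r := by
    have := min_le_right ρ₀ r; rw [hρ₂_def]; linarith [lt_min hρ₀ hr]
  set U : Set ℂ := ξ.target ∩ ξ.symm ⁻¹' ball 0 ρ₂ with hU_def
  have hUo : IsOpen U := ξ.continuousOn_symm.isOpen_inter_preimage ξ.open_target isOpen_ball
  have h0U : (0 : ℂ) ∈ U := ⟨h0tξ, by rw [mem_preimage, hξsymm0]; exact mem_ball_self hρ₂⟩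
  have hUy : ∀ w ∈ U, ξ (ξ.symm w) = w ∧ ξ.symm w ∈ ball (0 : ℂ) ρ₂ ∧
      ξ.symm w ∈ ball (0 : ℂ) ρ₀ ∧ ξ.symm w ∈ closedBall (0 : ℂ) r ∧ ξ.symm w ∈ ball (0 : ℂ) R := by
    rintro w ⟨hw1, hw2⟩
    refine ⟨ξ.right_inv hw1, hw2, ball_subset_ball hρ₂ρ₀.le hw2,
      ball_subset_closedBall (ball_subset_ball hρ₂r.le hw2),
      ball_subset_ball (hρ₂r.le.trans hrR.le) hw2⟩
  have hUρ₁ : U ⊆ ball 0 ρ₁ := fun w hw => by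
    obtain ⟨h1, -, h3, -, -⟩ := hUy w hw
    have := hξρ (ball_subset_ball hρ₀ρ h3); rwa [h1] at this
  have hûU : ContDiffOn ℝ 1 û U := hû.mono hUρ₁
  have hû0 : û 0 = 0 := by
    obtain ⟨c, -, hb⟩ := hûO.exists_pos
    have := hb.bound.self_of_nhds
    simpa using this
  -- the model curve agrees with `Θ ∘ f ∘ ξ⁻¹` on `U`
  have hFeq : ∀ w ∈ U, Θ (f (ξ.symm w)) = ((w ^ k, û w) : ℂ × ℂ) := fun w hw => by
    obtain ⟨h1, -, h3, -, -⟩ := hUy w hw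
    rw [(hrep₀ _ h3).2, h1]
  have hFev : ∀ w ∈ U,
      (fun w : ℂ => ((w ^ k, û w) : ℂ × ℂ)) =ᶠ[𝓝 w] fun w => Θ (f (ξ.symm w)) := fun w hw => by
    filter_upwards [hUo.mem_nhds hw] with w' hw'
    exact (hFeq w' hw').symm
  have hfd : ∀ y ∈ ball (0 : ℂ) R, DifferentiableAt ℝ f y := fun y hy =>
    (hf.differentiableOn (by simp)).differentiableAt (isOpen_ball.mem_nhds hy)
  have hFd : ∀ w ∈ U, fderiv ℝ (fun w : ℂ => ((w ^ k, û w) : ℂ × ℂ)) w =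
      (fderiv ℝ Θ (f (ξ.symm w))).comp ((fderiv ℝ f (ξ.symm w)).comp (fderiv ℝ ξ.symm w)) := by
    intro w hw
    obtain ⟨-, -, h3, -, h5⟩ := hUy w hw
    rw [(hFev w hw).fderiv_eq]
    exact (chartCurve_hasFDerivAt Θ hΘ1 ξ hξs hw.1 (hfd _ h5) (hrep₀ _ h3).1).fderiv
  obtain ⟨s₁, hs₁, hs₁U⟩ := Metric.isOpen_iff.1 hUo 0 h0U
  have hy0 : ∀ w ∈ U, w ≠ 0 → ξ.symm w ≠ 0 := fun w hw hw0 h => by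
    obtain ⟨h1, -⟩ := hUy w hw
    rw [h, hξ0] at h1
    exact hw0 h1.symm
  have hinjF : InjOn (fun z : ℂ => ((z ^ k, û z) : ℂ × ℂ)) (ball 0 s₁) := by
    intro w₁ hw₁ w₂ hw₂ heq
    have hU₁ := hs₁U hw₁
    have hU₂ := hs₁U hw₂
    obtain ⟨e₁, -, h₁, r₁, -⟩ := hUy w₁ hU₁
    obtain ⟨e₂, -, h₂, r₂, -⟩ := hUy w₂ hU₂
    have h1 : Θ (f (ξ.symm w₁)) = Θ (f (ξ.symm w₂)) := by
      rw [hFeq w₁ hU₁, hFeq w₂ hU₂]; exact heq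
    have h2 : f (ξ.symm w₁) = f (ξ.symm w₂) := Θ.injOn (hrep₀ _ h₁).1 (hrep₀ _ h₂).1 h1
    have h3 : ξ.symm w₁ = ξ.symm w₂ := hfinj r₁ r₂ h2
    rw [← e₁, ← e₂, h3]
  have himmF : ∀ w ∈ ball (0 : ℂ) s₁, w ≠ 0 →
      Function.Injective (fderiv ℝ (fun z : ℂ => ((z ^ k, û z) : ℂ × ℂ)) w) := by
    intro w hw hw0
    have hU' := hs₁U hw
    obtain ⟨-, -, h3, h4, h5⟩ := hUy w hU'
    rw [hFd w hU']
    exact (chartCurve_injective_invariant Θ hΘ1 hΘs1 ξ hξ hξs hU'.1 (hrep₀ _ h3).1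
      (hfJ _ h5) (hfimm _ h4 (hy0 w hU' hw0))).1
  have hFJ : ∀ w ∈ ball (0 : ℂ) s₁, w ≠ 0 → ∀ c : ℂ,
      (fderiv ℝ Θ (Θ.symm (w ^ k, û w))).comp ((J' (Θ.symm (w ^ k, û w))).comp
        (fderiv ℝ Θ.symm (w ^ k, û w)))
        (fderiv ℝ (fun z : ℂ => ((z ^ k, û z) : ℂ × ℂ)) w c) ∈
        LinearMap.range (fderiv ℝ (fun z : ℂ => ((z ^ k, û z) : ℂ × ℂ)) w : ℂ →ₗ[ℝ] ℂ × ℂ) := by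
    intro w hw hw0 c
    have hU' := hs₁U hw
    obtain ⟨-, -, h3, h4, h5⟩ := hUy w hU'
    rw [hFd w hU', ← hFeq w hU']
    exact (chartCurve_injective_invariant Θ hΘ1 hΘs1 ξ hξ hξs hU'.1 (hrep₀ _ h3).1
      (hfJ _ h5) (hfimm _ h4 (hy0 w hU' hw0))).2 c
  -- ### Step 6: the chart theorem
  obtain ⟨s, hs, δ, hδ, hsU, hchart⟩ := not_injOn_of_chartCusp hk2 hCS hm' hsum Θ.open_target
    h0tgt hJtc hJt2 hH hUo h0U hûU hû0 halign hdû hs₁ hinjF himmF hFJ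
  -- ### Step 7: compactness data for the limit curve
  set K : Set (EuclideanSpace ℝ (Fin 4)) := f '' closedBall 0 ρ₂ with hK_def
  have hρ₂R : closedBall (0 : ℂ) ρ₂ ⊆ ball 0 R :=
    closedBall_subset_ball (hρ₂r.trans hrR)
  have hKc : IsCompact K :=
    (isCompact_closedBall (0 : ℂ) ρ₂).image_of_continuousOn (hf.continuousOn.mono hρ₂R)
  have hKsrc : K ⊆ Θ.source := by
    rintro _ ⟨y, hy, rfl⟩
    exact (hrep₀ y (closedBall_subset_ball hρ₂ρ₀ hy)).1
  obtain ⟨τ, hτ, hτsrc⟩ := hKc.exists_cthickening_subset_open Θ.open_source hKsrc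
  set K₂ : Set (EuclideanSpace ℝ (Fin 4)) := cthickening τ K with hK₂_def
  have hK₂c : IsCompact K₂ := hKc.cthickening
  have hKK₂ : K ⊆ K₂ := self_subset_cthickening K
  -- uniform continuity of `Θ` and `DΘ` on `K₂`
  have hΘuc := Metric.uniformContinuousOn_iff.1
    (hK₂c.uniformContinuousOn_of_continuous (hΘ.continuousOn.mono hτsrc))
  have hDΘc : ContinuousOn (fderiv ℝ Θ) K₂ :=
    (hΘ1.continuousOn_fderiv_of_isOpen Θ.open_source le_rfl).mono hτsrc
  have hDΘuc := Metric.uniformContinuousOn_iff.1 (hK₂c.uniformContinuousOn_of_continuous hDΘc)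
  -- bounds
  obtain ⟨MA, hMA⟩ := hK₂c.exists_bound_of_continuousOn hDΘc
  have hDfc : ContinuousOn (fderiv ℝ f) (closedBall 0 r) :=
    ((hf.of_le (by norm_cast : (1 : WithTop ℕ∞) ≤ ∞)).continuousOn_fderiv_of_isOpen isOpen_ball
      le_rfl).mono (closedBall_subset_ball hrR)
  obtain ⟨MB, hMB⟩ := (isCompact_closedBall (0 : ℂ) r).exists_bound_of_continuousOn hDfc
  have hsξ : closedBall (0 : ℂ) s ⊆ ξ.target := fun w hw => (hsU hw).1
  have hDSc : ContinuousOn (fderiv ℝ ξ.symm) (closedBall 0 s) :=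
    (hξs.continuousOn_fderiv_of_isOpen ξ.open_target le_rfl).mono hsξ
  obtain ⟨MS, hMS⟩ := (isCompact_closedBall (0 : ℂ) s).exists_bound_of_continuousOn hDSc
  have hMA0 : 0 ≤ MA := (norm_nonneg _).trans (hMA _ (hKK₂ ⟨0, mem_closedBall_self hρ₂.le, rfl⟩))
  have hMB0 : 0 ≤ MB := (norm_nonneg _).trans (hMB 0 (mem_closedBall_self hr.le))
  have hMS0 : 0 ≤ MS := (norm_nonneg _).trans (hMS 0 (mem_closedBall_self hs.le))
  -- ### Step 8: the tolerances
  set εA : ℝ := δ / (2 * (MB + 1) * (MS + 1)) with hεA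
  set εB : ℝ := δ / (2 * (MA + 1) * (MS + 1)) with hεB
  have hεApos : 0 < εA := by positivity
  have hεBpos : 0 < εB := by positivity
  obtain ⟨ηΘ, hηΘ, hΘu⟩ := hΘuc δ hδ
  obtain ⟨ηA, hηA, hAu⟩ := hDΘuc εA hεApos
  have hev0 := Metric.tendstoUniformlyOn_iff.1 hC0 (min τ (min ηΘ ηA)) (by positivity)
  have hev1 := Metric.tendstoUniformlyOn_iff.1 hC1 (min 1 εB) (by positivity)
  filter_upwards [hev0, hev1] with n hn0 hn1 hinj'
  -- ### Step 9: the curve `g = Θ ∘ f'ₙ ∘ ξ⁻¹`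
  have hclose : ∀ y ∈ closedBall (0 : ℂ) r, dist (f' n y) (f y) < min τ (min ηΘ ηA) :=
    fun y hy => by rw [dist_comm]; exact hn0 y hy
  have hclose1 : ∀ y ∈ closedBall (0 : ℂ) r,
      ‖fderiv ℝ (f' n) y - fderiv ℝ f y‖ < min 1 εB :=
    fun y hy => by rw [← dist_eq_norm, dist_comm]; exact hn1 y hy
  have hK₂mem : ∀ y ∈ ball (0 : ℂ) ρ₂, f y ∈ K₂ ∧ f' n y ∈ K₂ := by
    intro y hy
    have hyK : f y ∈ K := ⟨y, ball_subset_closedBall hy, rfl⟩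
    refine ⟨hKK₂ hyK, Metric.mem_cthickening_of_dist_le _ (f y) _ _ hyK ?_⟩
    exact ((hclose y (ball_subset_closedBall (ball_subset_ball hρ₂r.le hy))).trans_le
      ((min_le_left _ _))).le
  have hsrc' : ∀ y ∈ ball (0 : ℂ) ρ₂, f' n y ∈ Θ.source := fun y hy => hτsrc (hK₂mem y hy).2
  have hf'd : ∀ y ∈ ball (0 : ℂ) R, DifferentiableAt ℝ (f' n) y := fun y hy =>
    ((hf' n).differentiableOn (by simp)).differentiableAt (isOpen_ball.mem_nhds hy)
  set g : ℂ → ℂ × ℂ := fun w => Θ (f' n (ξ.symm w)) with hg_def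
  have hgU : ContDiffOn ℝ 1 g U := by
    have h1 : ContDiffOn ℝ 1 ξ.symm U := hξs.mono fun w hw => hw.1
    have h2 : ContDiffOn ℝ 1 (f' n) (ball 0 R) := (hf' n).of_le (by norm_cast)
    refine hΘ1.comp (h2.comp h1 fun w hw => (hUy w hw).2.2.2.2) fun w hw => ?_
    exact hsrc' _ (hUy w hw).2.1
  have hgd : ∀ w ∈ closedBall (0 : ℂ) s, fderiv ℝ g w =
      (fderiv ℝ Θ (f' n (ξ.symm w))).comp ((fderiv ℝ (f' n) (ξ.symm w)).comp (fderiv ℝ ξ.symm w)) := by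
    intro w hw
    have hU' := hsU hw
    obtain ⟨-, h2, -, -, h5⟩ := hUy w hU'
    exact (chartCurve_hasFDerivAt Θ hΘ1 ξ hξs hU'.1 (hf'd _ h5) (hsrc' _ h2)).fderiv
  refine hchart g hgU ?_ ?_ ?_ ?_ ?_
  · -- (a) `C⁰`-closeness
    intro w hw
    have hU' := hsU hw
    obtain ⟨-, h2, -, h4, -⟩ := hUy w hU'
    rw [← hFeq w hU', ← dist_eq_norm]
    refine (hΘu _ (hK₂mem _ h2).2 _ (hK₂mem _ h2).1 ?_).le
    exact (hclose _ h4).trans_le ((min_le_right _ _).trans (min_le_left _ _))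
  · -- (b) `C¹`-closeness
    intro w hw
    have hU' := hsU hw
    obtain ⟨-, h2, -, h4, -⟩ := hUy w hU'
    rw [hgd w hw, hFd w hU']
    set y := ξ.symm w
    set A' := fderiv ℝ Θ (f' n y)
    set A := fderiv ℝ Θ (f y)
    set B' := fderiv ℝ (f' n) y
    set B := fderiv ℝ f y
    set T := fderiv ℝ ξ.symm w
    have hA'A : ‖A' - A‖ < εA := by
      rw [← dist_eq_norm]
      refine hAu _ (hK₂mem _ h2).2 _ (hK₂mem _ h2).1 ?_
      exact (hclose _ h4).trans_le ((min_le_right _ _).trans (min_le_right _ _))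
    have hB'B : ‖B' - B‖ < min 1 εB := hclose1 _ h4
    have hB'B1 : ‖B' - B‖ < 1 := hB'B.trans_le (min_le_left _ _)
    have hB'B2 : ‖B' - B‖ < εB := hB'B.trans_le (min_le_right _ _)
    have hAn : ‖A‖ ≤ MA := hMA _ (hK₂mem _ h2).1
    have hBn : ‖B‖ ≤ MB := hMB _ h4
    have hB'n : ‖B'‖ ≤ MB + 1 := by
      have := norm_le_insert' B' B  -- ‖B'‖ ≤ ‖B‖ + ‖B' - B‖
      linarith
    have hTn : ‖T‖ ≤ MS := hMS w hw
    rw [hεA] at hA'A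
    rw [hεB] at hB'B2
    exact opNorm_comp_comp_sub_le_of_tolerances A A' B B' T hδ.le hMA0 hMB0 hMS0 hA'A.le hB'B2.le
      hAn hB'n hTn
  · -- (c) immersion
    intro w hw
    have hU' := hsU hw
    obtain ⟨-, h2, -, h4, h5⟩ := hUy w hU'
    rw [hgd w hw]
    exact (chartCurve_injective_invariant Θ hΘ1 hΘs1 ξ hξ hξs hU'.1 (hsrc' _ h2)
      (hf'J n _ h5) (hf'imm n _ h4)).1
  · -- (d) `J̃`-invariance of the tangent lines
    intro w hw c
    have hU' := hsU hw
    obtain ⟨-, h2, -, h4, h5⟩ := hUy w hU'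
    rw [hgd w hw]
    exact (chartCurve_injective_invariant Θ hΘ1 hΘs1 ξ hξ hξs hU'.1 (hsrc' _ h2)
      (hf'J n _ h5) (hf'imm n _ h4)).2 c
  · -- (e) `g` is injective on `closedBall 0 s` if `f'ₙ` is injective on `closedBall 0 r`
    intro w₁ hw₁ w₂ hw₂ heq
    have hU₁ := hsU hw₁
    have hU₂ := hsU hw₂
    obtain ⟨e₁, h₁, -, r₁, -⟩ := hUy w₁ hU₁
    obtain ⟨e₂, h₂, -, r₂, -⟩ := hUy w₂ hU₂
    have h2 : f' n (ξ.symm w₁) = f' n (ξ.symm w₂) := Θ.injOn (hsrc' _ h₁) (hsrc' _ h₂) heq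
    have h3 : ξ.symm w₁ = ξ.symm w₂ := hinj' r₁ r₂ h2
    rw [← e₁, ← e₂, h3]

/-- **McDuff's Theorem 1.1 on the immersed locus (the target fact), modulo Wendl's Theorem B.23.**
`Literature.Geometry.Symplectic.jHolomorphic_immersed_of_limitEmbedded_punctured` follows from the
representation formula with branch comparison [Wendl2020, Thm B.23, (B.12)] (hypothesis `hX`):
combine `cusp_doublePoints_of_representationFormula` with the chart reduction
`jHolomorphic_immersed_of_limitEmbedded_punctured_of_flat` and the Weierstrass theorem
`JHolomorphicWeierstrassR4_holds`.
[cite: McDuff1991LocalBehaviour, Thm 1.1 and Thm 1.5; Wendl2020, App. B, Thm B.23] -/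
theorem jHolomorphic_immersed_of_limitEmbedded_punctured_of_representationFormula
    (hX : ∀ (F : Type) [NormedAddCommGroup F] [NormedSpace ℝ F] [FiniteDimensional ℝ F],
      Module.finrank ℝ F = 4 →
      ∀ (J : F → F →L[ℝ] F) (U : Set F), IsOpen U → ContDiffOn ℝ ∞ J U →
        (∀ x ∈ U, ∀ v : F, J x (J x v) = -v) →
      ∀ (u : ℂ → F) (z₀ : ℂ) (R : ℝ), 0 < R → ContDiffOn ℝ ∞ u (ball z₀ R) →
        MapsTo u (ball z₀ R) U →
        (∀ z ∈ ball z₀ R, ∀ α : ℂ, fderiv ℝ u z (Complex.I * α) = J (u z) (fderiv ℝ u z α)) →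
        (∃ᶠ z in 𝓝 z₀, u z ≠ u z₀) →
        ∃ (k : ℕ) (Θ : OpenPartialHomeomorph F (ℂ × ℂ)) (ξ : OpenPartialHomeomorph ℂ ℂ)
          (uhat : ℂ → ℂ) (ρ ρ₁ : ℝ),
          0 < k ∧ 0 < ρ ∧ 0 < ρ₁ ∧
          u z₀ ∈ Θ.source ∧ Θ (u z₀) = 0 ∧ ContDiffOn ℝ ∞ Θ Θ.source ∧
            ContDiffOn ℝ ∞ Θ.symm Θ.target ∧
          ball z₀ ρ ⊆ ξ.source ∧ ξ z₀ = 0 ∧ ContDiffOn ℝ 1 ξ ξ.source ∧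
            ContDiffOn ℝ 1 ξ.symm ξ.target ∧ ContDiffOn ℝ ∞ ξ (ξ.source \ {z₀}) ∧
          MapsTo ξ (ball z₀ ρ) (ball 0 ρ₁) ∧ ContDiffOn ℝ 1 uhat (ball 0 ρ₁) ∧
            (uhat =O[𝓝 0] fun w : ℂ => ‖w‖ ^ (k + 1)) ∧
            (∀ z ∈ ball z₀ ρ, u z ∈ Θ.source ∧ Θ (u z) = ((ξ z) ^ k, uhat (ξ z))) ∧
          ∀ ℓ : ℕ,
            (∀ᶠ w in 𝓝 (0 : ℂ),
              uhat (Complex.exp (2 * Real.pi * Complex.I * (ℓ / k : ℂ)) * w) = uhat w) ∨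
            ∃ (m : ℕ) (C : ℂ), k < m ∧ C ≠ 0 ∧
              (fun w : ℂ =>
                  uhat (Complex.exp (2 * Real.pi * Complex.I * (ℓ / k : ℂ)) * w) - uhat w -
                    C * w ^ m)
                =o[𝓝 (0 : ℂ)] fun w : ℂ => ‖w‖ ^ m) :
    jHolomorphic_immersed_of_limitEmbedded_punctured :=
  jHolomorphic_immersed_of_limitEmbedded_punctured_of_flat JHolomorphicWeierstrassR4_holds
    (cusp_doublePoints_of_representationFormula hX)

end CuspDoublePoints

end Literature.Geometry.Symplectic
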